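import Literature.MathematicalPhysics.QuantumFieldTheory.Balaban1983to89.B4Prop31Zero

/-!
# `Balaban1983to89.B4RegionCov1518` — B4 PROPOSITION 2.3 (1.15)–(1.18) AT `A = 0` FOR EVERY FINITE UNION
# `Ω^{(k)}` OF `L`-BLOCKS (beyond rectangular parallelepipeds), by the route of B4 Section 5

**Source.** T. Bałaban, *Regularity and Decay of Lattice Green's Functions*, Commun. Math. Phys. **89**, 571–597 (1983)
(bib key `Balaban1983RegularityDecay`, «B4» of the 1983–89 series), pp. 572–574 ((1.1)–(1.18)), p. 593 ((5.1)–(5.4)),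
p. 594 (the Theorem of Section 5, (5.6)–(5.8)).  Quoted from the rendered pages
`b2b-balaban-ref1/pages/1983-cmp89-regularity-decay/…-p002-x2.png`, `…-p003-x2.png`, `…-p004-x2.png`, `…-p023-x2.png`,
`…-p024-x2.png` (PDF pp. 2, 3, 4, 23, 24 = journal pp. 572, 573, 574, 593, 594), read as images.

**WHAT IS PRINTED (verbatim).**  p. 572: «We consider also a second division of ηZ^d into cubes of size M called big
blocks. […] Here M is a large positive integer defined later in this paper. We consider subsets Ω which are unions of
big blocks.»; (1.6) «G_k(Ω, A) = (−Δ^{η,N}_{A,Ω} + m² + aP_k(A))^{−1}, where m² ≧ 0 and a is a positive constant close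
to 1.»  p. 573: «Let us recall that for operators X defined on the unit lattice functions we define the operator X|_Λ
restricted to a subset Λ by X|_Λ = ΛXΛ, where Λ also denotes the characteristic function of the set Λ. We have
C_Λ^{(k)}(Ω, A) = ((Δ^{(k)}(Ω, A) + aL^{−2}P(A))|_Λ)^{−1}. (1.13)  Here Δ^{(k)}(Ω, A) is an operator of the effective
Gaussian action after k renormalization transformations and can be defined by
Δ^{(k)}(Ω, A) = a_kI − a_k²Q_k(A)G_k(Ω, A)Q_k^*(A), (1.14) where a_k is a constant proportional to a.»  p. 574:
«**Proposition 2.3 of [1].** There exist positive constants δ₀, c₀, γ₀, γ₁ dependent on d and M only and such that for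
arbitrary Λ ⊂ Ω^{(k)} = Ω∩Z^d, Λ being a sum of big blocks and for e sufficiently small, we have
γ₀I ≦ Δ^{(k)}(Ω, A) + aL^{−2}P(A) ≦ γ₁I, (1.15)  |C_Λ^{(k)}(Ω, A; x, x′)| ≦ c₀ exp(−δ₀|x − x′|), x, x′ ∈ Λ. (1.16)  In
particular the above inequality holds for C^{(k)}(Ω, A). Putting δC_Λ^{(k)}(Ω, A) = C_Λ^{(k)}(Ω, A) − C^{(k)}(Ω, A), (1.17)
we have also |δC_Λ^{(k)}(Ω, A; x, x′)| ≦ c₀ exp(−δ₀(|x − x′| + dist(x, Λ^c) + dist(x′, Λ^c))), x, x′ ∈ Λ. (1.18)».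
p. 593 (Section 5, «A General Theorem on Unit Lattice Operators»): «At first let us prove that the bounds (1.11) are
consequences of Proposition II.3.1′. The upper bound is quite elementary because
Δ^{(k)}(Ω, A) + aL^{−2}P(A) = a_kI − a_k²Q_k(A)G_k(Ω, A)Q_k^*(A) + aL^{−2}P(A) ≦ a_kI + aL^{−2}Q^*(A)Q(A) ≦ (a_k + aL^{−2})I
= a(a_k/a_{k+1})I. (5.1) The operators are considered as defined on L²(Ω^{(k)}). To prove the lower bound we apply
Proposition II.3.1′ to Δ^{(k)}(Ω, A): ⟨φ, (Δ^{(k)}(Ω, A) + aL^{−2}P(A))φ⟩ ≧ γ₀ Σ_{⟨x,x′⟩⊂Ω^{(k)}} |U(A(⟨x, x′⟩))φ(x′) − φ(x)|²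
+ aL^{d−2} Σ_{y∈Ω^{(k+1)}} |L^{−d} Σ_{x∈B(y)} U(A(Γ_{y,x}))φ(x)|² − O(e^{2−δ}) Σ_{x∈Ω^{(k)}} |φ(x)|². (5.2) […] we obtain
the Laplace operator with Neumann boundary conditions for each block plus the projection operator on constant
functions. This sum is bounded from below by a positive constant (more precisely by ½γ₀ min{π²L^{−2}, aL^{−2}}),
thus we have ⟨φ, (Δ^{(k)}(Ω, A) + aL^{−2}P(A))φ⟩ ≧ γ₀′⟨φ, φ⟩ − O(e^{2−δ})⟨φ, φ⟩ ≧ γ₀″⟨φ, φ⟩. (5.3) for e sufficiently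
small and we get the lower bound. Finally Corollary 2.3 implies that the considered operator is short-ranged in the
sense that for some δ₀ > 0  |(Δ^{(k)}(Ω, A) + aL^{−2}P(A))(x, x′)| ≦ c₀e^{−δ₀|x−x′|}, x, x′ ∈ Ω^{(k)}, (5.4)».  p. 594:
«**Theorem.** Let Ω ⊂ Z^d and let A be a symmetric operator defined on the space L²(Ω) of functions φ : Ω → R^N and
satisfying the following condition: there exist positive constants γ₀, c₀, δ₀ such that
A ≧ γ₀I, |A(x, x′)| ≦ c₀e^{−δ₀|x−x′|}, x, x′ ∈ Ω. (5.6)  Then there exist positive constants c₁, δ₁ such that for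
arbitrary Λ ⊂ Ω and for C_Λ = A_Λ^{−1}, A_Λ is an operator defined on L²(Λ) by A_Λ = ΛAΛ. We have
|C_Λ(x, x′)| ≦ c₁e^{−δ₁|x−x′|}, x, x′ ∈ Λ, (5.7)  |δC_Λ(x, x′)| ≦ c₁e^{−δ₁(|x−x′| + dist(x, Λ^c) + dist(x′, Λ^c))},
δC_Λ = C_Λ − C_Ω. (5.8)».

**WHAT THIS FILE CERTIFIES (kernel-checked, zero `sorry`, case `A = 0`).**  The lineage's certificates of (1.15)–(1.18)
at `A = 0` (`B4BoxCov237` §5–§9, `B4TwoBox120`, `B4Prop23ZeroBox`) are for RECTANGULAR PARALLELEPIPEDS `Ω = □` built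
of `L`-blocks, because their short-range input is (2.35)–(2.37) for boxes.  This file proves (1.15)–(1.18) at `A = 0`
for EVERY finite `Ω^{(k)} ⊂ ℤ^{d+1}` that is a union of `L`-blocks (`B4Lower18.IsBlockUnion L Ω`, `L = ℓ + 1 ≥ 2`) —
the fine region being `Ω = B^k(Ω^{(k)})` (`B4Prop31Zero.fineDom n Ω`, Neumann boundary conditions = bonds inside) —
following the print's own second route (Section 5):
* (5.1)–(5.3) ↦ `covR_form_le`, `covR_form_ge` (§4): `γ₀‖ψ‖² ≤ ⟨ψ, (Δ^{(k)}(Ω,0) + aL^{−2}P(0))ψ⟩ ≤ (a_k + aL^{−2})‖ψ‖²`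
  with the EXPLICIT `γ₀ = min(a_k/(8(d+1)+2m²), 1/8)·min(2, a)/L²`, for every mesh and every block union; the
  Proposition II.3.1′ input is the package's (1.22) at `A = 0` (`B4Prop31Zero.KeffR_form_ge`), and the «Laplace
  operator with Neumann boundary conditions for each block plus the projection operator on constant functions»
  step is the package's (1.8) at `A = 0` on the UNIT lattice with mesh parameter `L` (`B4Lower18.lower18_zero` with
  `B4Lower18.fineOpR_form`, `pairSum_le_two_dirS`);
* (5.4) ↦ `covR_entry_decay` (§5): `|(Δ^{(k)}(Ω,0) + aL^{−2}P(0))(y, y′)| ≤ c·e^{−δ|y − y′|_∞}` for every mesh and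
  every finite `Ω^{(k)}`, by a Combes–Thomas set-to-set bound for the MASSIVE lattice Green's function `G_k(Ω, 0)`,
  uniform in the mesh, the region and `m² ≥ 0` (`setDecay_region_mass`, §1; the print invokes Corollary 2.3 here,
  which the package has at `A = 0` only for boxes), with the admissible rate `ctRate` of the window (§6);
* (5.6) ↦ `covR_hyp56` (§6): `B4Sect5Torus.Hyp56 (rhoS Ω) (covR n L a_k a m² Ω) γ₀ c₀ κ` uniformly on the window
  `a_k ∈ [a₋, a₊]`, `m² ∈ [0, m²₊]`, `a ∈ [a₂₋, a₂₊]`, every `n ≥ 1`, every block union `Ω^{(k)}`;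
* (1.15) ↦ `cov115_region_form_bounds`; (1.16) = (5.7) ↦ `cov116_region_sub_decay` (every injection
  `e : m → Ω^{(k)}`, i.e. EVERY `Λ ⊆ Ω^{(k)}`; invertibility of the compression included), `cov116_region_finset_decay`
  (`Λ` a `Finset`), `cov116_region_decay` (`Λ = Ω^{(k)}`: `C^{(k)}(Ω, 0)` exists and decays); (1.17)–(1.18) = (5.8) ↦
  `cov118_region_sub_delta` (every weight `β ≤ dist_∞(·, Ω^{(k)} ∖ Λ)`), `cov118_region_finset_delta` (the weight
  `distCS Λ` = `dist_∞(·, Ω^{(k)} ∖ Λ)`) — all from the package's kernel proof of the Theorem of Section 5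
  (`B4Sect5Torus.inv_submatrix_decay`, `B4Sect5Torus.deltaC_bound`);
* §8: non-vacuity (`d + 1 = 4`, `L = 2`, window `[1/2, 2] × [0, 1] × [1/2, 2]`), and an `L`-shaped block union that is
  not a box.

**DICTIONARY (print ↦ Lean, all at `A = 0`, `U ≡ 1`).** `η = L^{−k}` ↦ `1/n` for an arbitrary `n ≥ 1` (the statements
hold for every mesh; the print's case is `n = L^k`); `d` ↦ `d + 1`; `L` ↦ `L = ℓ + 1 ≥ 2`; `Ω^{(k)} = Ω∩Z^d` ↦ a
`Finset (Fin (d+1) → ℤ)` `Ω` with `IsBlockUnion L Ω`; `Ω` (fine region) ↦ `fineDom n Ω = B^k(Ω^{(k)})`;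
`G_k(Ω, 0) = (−Δ^{η,N}_Ω + m² + aP_k)^{−1}` ↦ `(B4Lower18.fineOpR n a_k m² (fineDom n Ω))⁻¹` in lattice units (the
operator (1.6) times `η²·η^{−(d+1)}`-normalisations fixed in `B4Lower18`/`B4Prop31Zero`); `Q_k`, `Q_k^*` ↦
`B4Prop31Zero.indR` (block sums, the `η^{d+1}` weights carried by the scalar factor); `Δ^{(k)}(Ω, 0)` (1.14) ↦
`B4Prop31Zero.KeffR n a_k m² Ω`; `P(A)` at `A = 0` (the averaging projection over `L`-blocks of the unit lattice, cf.
the middle term of (5.2)) ↦ `projL L Ω` (entries `L^{−(d+1)}·[same L-block]`); `Δ^{(k)}(Ω,0) + aL^{−2}P(0)` ↦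
`covR n L a_k a m² Ω`; `X|_Λ = ΛXΛ` ↦ `covRSub … e = (covR …).submatrix e e` for an injection `e : m → Ω^{(k)}`
(`Λ` = its range); `C_Λ^{(k)}(Ω, 0)` ↦ `(covRSub … e)⁻¹` (`Matrix.inv`, the genuine inverse by the first conjunct of
`cov116_region_sub_decay`); `C^{(k)}(Ω, 0)` ↦ `(covR …)⁻¹`; `|x − x′|` ↦ `supNorm (x − x′)` (`rhoS`); `dist(x, Λ^c)` ↦
`distCS Λ x` (complement inside `Ω^{(k)}`) or any weight `β` it dominates; (5.6) ↦ `B4Sect5Torus.Hyp56`.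

**HONEST SCOPE — what is NOT certified here.** (i) Only `A = 0`: «for e sufficiently small», the regularity (1.7) and
the `O(e^{2−δ})` terms of (5.2)–(5.3) — the content of B4 §§2–4 for `A ≠ 0` — are absent.  (ii) `Ω^{(k)}` ranges over
finite unions of `L`-blocks of `ℤ^{d+1}`; the print's `Ω` («unions of big blocks» of size `M`) are among them exactly
when `L` divides `M` (the operator `P(A)` averages over `L`-blocks of `Ω^{(k)}`, so (1.15) presupposes that `Ω^{(k)}` is
such a union); nothing is claimed for infinite `Ω`.  (iii) «Λ being a sum of big blocks» is NOT imposed: at `A = 0` the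
certificates hold for EVERY `Λ ⊆ Ω^{(k)}` (formally stronger in this respect); `Λ^c` in (1.18) is read inside `Ω^{(k)}`.
(iv) (1.19)–(1.20) (two regions `Ω ⊂ Ω₀`) are NOT treated here (the package has them at `A = 0` for nested Neumann
boxes only, `B4TwoBox120`); consequently no instance of the typed `B4.Prop23Printed` for general regions is claimed,
and `DagBinding`/`DagDischarged` are not edited (one writer).  (v) The lower constant is the package's
`min(a_k/(8(d+1)+2m²), 1/8)·min(2,a)·L^{−2}`, obtained through (1.22) and (1.8) at `A = 0`, not the print's
`½γ₀ min{π²L^{−2}, aL^{−2}}` (no claim about `π²`); the short range (5.4) is proved by a Combes–Thomas argument on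
`G_k(Ω, 0)` (mechanism of `CombesThomas1973`, kernel-proved in `Beta.CombesThomasFormOp`), not through Corollary 2.3.
(vi) All constants are existential, depend on `d`, `ℓ` AND the parameter window (print: «dependent on d and M only»),
and decay is in the sup norm `|·|_∞` (equivalent to the Euclidean norm up to `√(d+1)` in the rates).  (vii) The form
bounds need `IsBlockUnion L Ω^{(k)}`; the entry decay (5.4) and the Combes–Thomas bounds of §1, §5 hold for every
finite `Ω^{(k)}`.

**Value = kernel certificate (the print's Section-5 route to (1.15)–(1.18) carried out at `A = 0` for general block
unions), NOT summit progress**: the Yang–Mills / `Summit.QuantumFields` statements are untouched; no Literature fact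
is minted — every hypothesis used is kernel-proved in this package.
-/

namespace Literature.MathematicalPhysics.QuantumFieldTheory.Balaban1983to89.B4RegionCov1518

open Finset Matrix
open Literature.MathematicalPhysics.QuantumFieldTheory.Balaban1983to89.B4ContourShift (supNorm supNorm_nonneg
  abs_le_supNorm)
open Literature.MathematicalPhysics.QuantumFieldTheory.Balaban1983to89.B4Reflection242
open Literature.MathematicalPhysics.QuantumFieldTheory.Balaban1983to89.B4Green242Bridge
open Literature.MathematicalPhysics.QuantumFieldTheory.Balaban1983to89.B4BoxCov237
open Literature.MathematicalPhysics.QuantumFieldTheory.Balaban1983to89.B4Lower18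
open Literature.MathematicalPhysics.QuantumFieldTheory.Balaban1983to89.B4Prop31Zero
open B4Green244 (finePt)
open B4Sect5Torus (IsPseudoDist SumBound Hyp56 rate rate_pos bigC bigC_nonneg hyp56_submatrix isUnit_of_hyp56
  inv_submatrix_decay deltaC_bound)
open B4Sect5Proof (latticeConst latticeConst_nonneg latticeSum_le)
open Beta.CombesThomasForm (lap lap_form lapDefect_le blockDefect_le)
open Beta.CombesThomasFormOp (setDecay_form_op conjError_lap_add_blocks_ge distTo distTo_le le_distTo
  distTo_le_zero_of_mem abs_distTo_sub_le)

noncomputable section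

variable {d : ℕ}

/-! ## §1  Combes–Thomas set-to-set decay for the MASSIVE fine operator `n²(−Δ^N_R) + m² + (a/n^{d+1})1_{blk}`,
`m² ≥ 0`, uniformly in the mesh, the region and the mass -/

/-- the `η`-scaled sup-distance is symmetric. [folklore] -/
theorem edistR_symm (n : ℕ) (R : Finset (Fin (d + 1) → ℤ)) (x y : ↥R) : edistR n R x y = edistR n R y x := by
  simp only [edistR]
  rw [← B4TorusKernel.supNorm_neg, neg_sub]

/-- the `η`-scaled sup-distance vanishes on the diagonal. [folklore] -/
theorem edistR_self (n : ℕ) (R : Finset (Fin (d + 1) → ℤ)) (x : ↥R) : edistR n R x x = 0 := by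
  simp [edistR, supNorm_zero']

/-- the `η`-scaled sup-distance satisfies the triangle inequality. [folklore] -/
theorem edistR_triangle {n : ℕ} (hn : 1 ≤ n) (R : Finset (Fin (d + 1) → ℤ)) (x y z : ↥R) :
    edistR n R x z ≤ edistR n R x y + edistR n R y z := by
  have hn0 : (0 : ℝ) < n := by exact_mod_cast hn
  simp only [edistR]
  rw [← mul_add]
  refine mul_le_mul_of_nonneg_left ?_ (by positivity)
  have := supNorm_add_le (x.1 - y.1) (y.1 - z.1)
  rwa [sub_add_sub_cancel] at this

/-- **THE CONJUGATION ERROR OF THE MASSLESS OPERATOR** `H₀ = n²(−Δ^N_R) + (a/n^{d+1})1_{same block}` for the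
Combes–Thomas weight `φ = δ·dist_η(·, T)`: `Σ_{j,k}(e^{φ_j − φ_k} − 1)H₀(j,k)w_jw_k ≥ −(2(d+1)δ² + a(e^δ − 1))‖w‖²`
(`Beta.CombesThomasFormOp.conjError_lap_add_blocks_ge` with the lattice defects `lapDefect_le`, `blockDefect_le`,
exactly the data of `B4Lower18.setDecay_region`). [cite: CombesThomas1973, §II] [folklore] -/
theorem conjError_fineOpR_zero {n : ℕ} (hn : 1 ≤ n) {R : Finset (Fin (d + 1) → ℤ)} (hR : IsBlockUnion n R)
    {a δ : ℝ} (ha : 0 < a) (hδ0 : 0 ≤ δ) (hδ1 : δ ≤ 1) (T : Finset ↥R) (hT : T.Nonempty) (w : ↥R → ℝ) :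
    -(2 * ((d : ℝ) + 1) * δ ^ 2 + a * (Real.exp δ - 1)) * (w ⬝ᵥ w)
      ≤ ∑ j, ∑ k, (Real.exp (δ * distTo (edistR n R) T hT j - δ * distTo (edistR n R) T hT k) - 1)
          * fineOpR n a 0 R j k * (w j * w k) := by
  classical
  have hn0 : (0 : ℝ) < n := by exact_mod_cast hn
  have hn1 : (1 : ℝ) ≤ n := by exact_mod_cast hn
  have hη : (0 : ℝ) < 1 / (n : ℝ) := by positivity
  have hη1 : 1 / (n : ℝ) ≤ 1 := by rw [div_le_one hn0]; exact hn1
  have hcard : ∀ b : ↥(R.image (blk n)), ((Finset.univ.filter fun i => rblk n R i = b).card : ℝ)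
      = (n : ℝ) ^ (d + 1) := by
    intro b
    rw [card_filter_rblk hn hR b]
    push_cast
    rfl
  set φ : ↥R → ℝ := fun j => δ * distTo (edistR n R) T hT j with hφ
  have hlip : ∀ j k, |φ j - φ k| ≤ δ * edistR n R j k := by
    intro j k
    simp only [hφ]
    rw [← mul_sub, abs_mul, abs_of_nonneg hδ0]
    exact mul_le_mul_of_nonneg_left
      (abs_distTo_sub_le (edistR n R) (edistR_symm n R) (edistR_triangle hn R) T hT j k) hδ0
  have hε0 : 0 ≤ Real.exp δ - 1 := by linarith [Real.add_one_le_exp δ]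
  have h1 : δ * (1 / (n : ℝ)) ≤ 1 := by
    calc δ * (1 / (n : ℝ)) ≤ 1 * 1 := mul_le_mul hδ1 hη1 hη.le zero_le_one
      _ = 1 := one_mul 1
  have hc : ∀ j k : ↥R, adjC n R j k ≠ 0 → adjC n R j k = ((1 / (n : ℝ)) ^ 2)⁻¹ ∧ |φ j - φ k| ≤ δ * (1 / (n : ℝ)) := by
    intro j k hjk
    have hadj : k.1 ∈ nbrs j.1 := by
      by_contra h
      exact hjk (if_neg h)
    refine ⟨?_, ?_⟩
    · simp only [adjC, hadj, if_true]
      field_simp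
    · refine (hlip j k).trans (mul_le_mul_of_nonneg_left ?_ hδ0)
      show (1 / (n : ℝ)) * supNorm (j.1 - k.1) ≤ 1 / (n : ℝ)
      calc (1 / (n : ℝ)) * supNorm (j.1 - k.1) ≤ (1 / (n : ℝ)) * 1 :=
            mul_le_mul_of_nonneg_left (supNorm_sub_le_one_of_mem_nbrs hadj) hη.le
        _ = 1 / (n : ℝ) := mul_one _
  have hΘ : ∀ j k : ↥R, rblk n R j = rblk n R k → |φ j - φ k| ≤ δ := by
    intro j k hjk
    have hb : blk n j.1 = blk n k.1 := by
      have := congrArg Subtype.val hjk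
      exact this
    refine (hlip j k).trans ?_
    have hd1 : edistR n R j k ≤ 1 := by
      show (1 / (n : ℝ)) * supNorm (j.1 - k.1) ≤ 1
      calc (1 / (n : ℝ)) * supNorm (j.1 - k.1) ≤ (1 / (n : ℝ)) * ((n : ℝ) - 1) :=
            mul_le_mul_of_nonneg_left (supNorm_sub_le_of_blk_eq hn hb) hη.le
        _ ≤ 1 := by rw [div_mul_eq_mul_div, one_mul, div_le_one hn0]; linarith
    calc δ * edistR n R j k ≤ δ * 1 := mul_le_mul_of_nonneg_left hd1 hδ0
      _ = δ := mul_one δ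
  have h := conjError_lap_add_blocks_ge (adjC n R) (adjC_symm n R) (adjC_nonneg n R) (rblk n R)
    (fun b => a / ((Finset.univ.filter fun i => rblk n R i = b).card : ℝ))
    (fun b => div_nonneg ha.le (Nat.cast_nonneg _))
    (fun b j => if rblk n R j = b then (1 : ℝ) else 0) (fun b j hj => if_neg hj)
    (fineOpR n a 0 R) (fineOpR_zero_eq hn hR a) φ (2 * ((d : ℝ) + 1) * δ ^ 2) (a * (Real.exp δ - 1))
    (lapDefect_le (adjC n R) φ hη h1 hc (fun j => card_filter_adjC_ne_zero_le n R j))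
    (fun _ => Real.exp δ - 1) (fun _ => hε0)
    (fun b j k hj hk => blockDefect_le (rblk n R) φ δ hΘ b j k hj hk) (fun b => ?_) w
  · simpa [hφ] using h
  · -- block strengths: (a/|B|)·(e^δ − 1)·|B| = a(e^δ − 1)
    have hsq : ∑ k : ↥R, (if rblk n R k = b then (1 : ℝ) else 0) ^ 2
        = ((Finset.univ.filter fun i => rblk n R i = b).card : ℝ) := by
      simp_rw [ite_pow, one_pow, zero_pow two_ne_zero]
      rw [Finset.sum_boole]
    rw [hsq, hcard]
    have hpow : ((n : ℝ) ^ (d + 1)) ≠ 0 := by positivity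
    rw [mul_assoc, mul_comm (Real.exp δ - 1), ← mul_assoc, div_mul_cancel₀ a hpow]

/-- **SET-TO-SET DECAY OF THE MASSIVE GREEN'S FUNCTION `G_k(Ω, 0) = (−Δ^{η,N}_Ω + m² + aP_k)⁻¹`, `m² ≥ 0`,
UNIFORMLY IN THE MESH, THE REGION AND THE MASS** (the `m² = 0` case is `B4Lower18.setDecay_region`): for `a > 0`,
`m² ≥ 0`, every mesh `η = 1/n`, every finite union `R` of blocks, `0 ≤ δ ≤ 1` with
`2(d+1)δ² + a(e^δ − 1) ≤ min(2,a)/2`, `g` supported in a nonempty `T`, `S` at `η`-sup-distance `≥ ρ` from `T` and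
`(n²(−Δ^N_R) + m² + (a/n^{d+1})1_{blk})v = g`: `Σ_{x∈S} v(x)² ≤ (2/min(2,a))²e^{−2δρ}Σ_x g(x)²`.  Mechanism: the
mass term is diagonal, so it does not contribute to the conjugation error (`conjError_fineOpR_zero`), while it only
improves the coercivity `min(2,a) + m² ≥ min(2,a)` (`B4Lower18.lower18`); `Beta.CombesThomasFormOp.setDecay_form_op`.
[cite: CombesThomas1973, §II] [folklore] -/
theorem setDecay_region_mass {n : ℕ} (hn : 1 ≤ n) {R : Finset (Fin (d + 1) → ℤ)} (hR : IsBlockUnion n R)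
    {a m2 δ : ℝ} (ha : 0 < a) (hm : 0 ≤ m2) (hδ0 : 0 ≤ δ) (hδ1 : δ ≤ 1)
    (hsmall : 2 * ((d : ℝ) + 1) * δ ^ 2 + a * (Real.exp δ - 1) ≤ min 2 a / 2)
    (S T : Finset ↥R) (hT : T.Nonempty) (ρ : ℝ) (hρ : ∀ x ∈ S, ∀ t ∈ T, ρ ≤ edistR n R x t)
    (g v : ↥R → ℝ) (hg : ∀ x, x ∉ T → g x = 0) (hv : (fineOpR n a m2 R).mulVec v = g) :
    ∑ x ∈ S, v x ^ 2 ≤ (2 / min 2 a) ^ 2 * Real.exp (-(2 * (δ * ρ))) * ∑ x, g x ^ 2 := by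
  classical
  have hσ : 0 < min 2 a := lt_min (by norm_num) ha
  set φ : ↥R → ℝ := fun j => δ * distTo (edistR n R) T hT j with hφ
  have hpos : ∀ ω : ↥R → ℝ, min 2 a * (ω ⬝ᵥ ω) ≤ ω ⬝ᵥ (fineOpR n a m2 R).mulVec ω := by
    intro ω
    have h := lower18 hn ha.le m2 hR ω
    have hww : 0 ≤ ω ⬝ᵥ ω := by
      unfold dotProduct
      exact Finset.sum_nonneg fun j _ => mul_self_nonneg _
    nlinarith
  have herr : ∀ w : ↥R → ℝ, -(min 2 a / 2) * (w ⬝ᵥ w)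
      ≤ ∑ j, ∑ k, (Real.exp (φ j - φ k) - 1) * fineOpR n a m2 R j k * (w j * w k) := by
    intro w
    have hsum : ∑ j, ∑ k, (Real.exp (φ j - φ k) - 1) * fineOpR n a m2 R j k * (w j * w k)
        = ∑ j, ∑ k, (Real.exp (φ j - φ k) - 1) * fineOpR n a 0 R j k * (w j * w k) := by
      refine Finset.sum_congr rfl fun j _ => Finset.sum_congr rfl fun k _ => ?_
      rw [fineOpR_eq_add_smul n a m2 R, Matrix.add_apply, Matrix.smul_apply, Matrix.one_apply]
      by_cases hjk : j = k
      · subst hjk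
        simp
      · simp [hjk]
    rw [hsum]
    have h0 := conjError_fineOpR_zero hn hR ha hδ0 hδ1 T hT w
    have hww : 0 ≤ w ⬝ᵥ w := by
      unfold dotProduct
      exact Finset.sum_nonneg fun j _ => mul_self_nonneg _
    have hk : -(min 2 a / 2) * (w ⬝ᵥ w) ≤ -(2 * ((d : ℝ) + 1) * δ ^ 2 + a * (Real.exp δ - 1)) * (w ⬝ᵥ w) := by
      nlinarith
    exact hk.trans (by simpa [hφ] using h0)
  have h := setDecay_form_op (fineOpR n a m2 R) (min 2 a) φ hσ hpos herr S T (δ * ρ) 0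
    (fun i hi => ?_) (fun j hj => ?_) g v hg hv
  · simpa using h
  · -- on `S` the weight is `≥ δρ`
    exact mul_le_mul_of_nonneg_left (le_distTo (edistR n R) T hT fun t ht => hρ i hi t ht) hδ0
  · -- on `T` the weight is `≤ 0`
    exact mul_nonpos_iff.2 (Or.inl ⟨hδ0, distTo_le_zero_of_mem (edistR n R) (edistR_self n R) T hT hj⟩)

/-- **THE GREEN'S FUNCTION VERSION** (`G = (fineOpR n a m2 R)⁻¹` a genuine inverse for `a > 0`, `m² ≥ 0`): for `g`
supported in `T`, `Σ_{x∈S}(Gg)(x)² ≤ (2/min(2,a))²e^{−2δ·dist_η(S,T)}Σ_x g(x)²` —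
`‖1_S G_k(Ω,0) 1_T‖ ≤ (2/min(2,a))e^{−δ dist_η(S,T)}` uniformly in `η`, `Ω` and `m² ≥ 0`.
[cite: CombesThomas1973, §II] [folklore] -/
theorem green_setDecay_region_mass {n : ℕ} (hn : 1 ≤ n) {R : Finset (Fin (d + 1) → ℤ)} (hR : IsBlockUnion n R)
    {a m2 δ : ℝ} (ha : 0 < a) (hm : 0 ≤ m2) (hδ0 : 0 ≤ δ) (hδ1 : δ ≤ 1)
    (hsmall : 2 * ((d : ℝ) + 1) * δ ^ 2 + a * (Real.exp δ - 1) ≤ min 2 a / 2)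
    (S T : Finset ↥R) (hT : T.Nonempty) (ρ : ℝ) (hρ : ∀ x ∈ S, ∀ t ∈ T, ρ ≤ edistR n R x t)
    (g : ↥R → ℝ) (hg : ∀ x, x ∉ T → g x = 0) :
    ∑ x ∈ S, ((fineOpR n a m2 R)⁻¹.mulVec g) x ^ 2
      ≤ (2 / min 2 a) ^ 2 * Real.exp (-(2 * (δ * ρ))) * ∑ x, g x ^ 2 := by
  refine setDecay_region_mass hn hR ha hm hδ0 hδ1 hsmall S T hT ρ hρ g _ hg ?_
  have hpos : 0 < min 2 a + m2 := add_pos_of_pos_of_nonneg (lt_min (by norm_num) ha) hm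
  rw [Matrix.mulVec_mulVec, fineOpR_mul_inv hn ha.le hpos hR, Matrix.one_mulVec]


/-! ## §2  Geometry: the fine blocks over two unit labels at sup-distance `s` are at `η`-distance `≥ s − 1` -/

/-- `n·|⌊x/n⌋ − ⌊t/n⌋| ≤ |x − t| + (n − 1)` for integers. [folklore] -/
theorem natMul_abs_ediv_sub_ediv_le {n : ℕ} (hn : 1 ≤ n) (x t : ℤ) :
    (n : ℤ) * |x / n - t / n| ≤ |x - t| + ((n : ℤ) - 1) := by
  have hn0 : (0 : ℤ) < n := by exact_mod_cast hn
  have hx := Int.mul_ediv_add_emod x n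
  have ht := Int.mul_ediv_add_emod t n
  have h1 := Int.emod_nonneg x hn0.ne'
  have h2 := Int.emod_lt_of_pos x hn0
  have h3 := Int.emod_nonneg t hn0.ne'
  have h4 := Int.emod_lt_of_pos t hn0
  have key : (n : ℤ) * (x / n - t / n) = (x - t) - (x % n - t % n) := by
    rw [mul_sub]
    linarith
  have habs : (n : ℤ) * |x / n - t / n| = |(x - t) - (x % n - t % n)| := by
    rw [← key, abs_mul, abs_of_pos hn0]
  rw [habs]
  have hr : |x % n - t % n| ≤ (n : ℤ) - 1 := by
    rw [abs_le]
    constructor <;> linarith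
  calc |(x - t) - (x % n - t % n)| ≤ |x - t| + |x % n - t % n| := abs_sub _ _
    _ ≤ |x - t| + ((n : ℤ) - 1) := add_le_add le_rfl hr

/-- block labels contract sup-distances up to the block diameter: `|blk x − blk t|_∞ ≤ (|x − t|_∞ + n − 1)/n`.
[folklore] -/
theorem supNorm_blk_sub_blk_le {n : ℕ} (hn : 1 ≤ n) (x t : Fin (d + 1) → ℤ) :
    supNorm (blk n x - blk n t) ≤ (supNorm (x - t) + ((n : ℝ) - 1)) / n := by
  have hn0 : (0 : ℝ) < n := by exact_mod_cast hn
  refine supNorm_le_of_forall fun i => ?_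
  rw [le_div_iff₀ hn0]
  have h := natMul_abs_ediv_sub_ediv_le hn (x i) (t i)
  have hR : (n : ℝ) * ((|x i / n - t i / n| : ℤ) : ℝ) ≤ ((|x i - t i| : ℤ) : ℝ) + ((n : ℝ) - 1) := by
    exact_mod_cast h
  have hsup := abs_le_supNorm (x - t) i
  rw [Pi.sub_apply] at hsup
  have hblk : (blk n x - blk n t) i = x i / n - t i / n := by simp [blk]
  rw [hblk]
  linarith

/-- **BLOCK GEOMETRY**: fine points `x ∈ B(y)`, `t ∈ B(y′)` (`blk n x = y`, `blk n t = y′`) satisfy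
`η|x − t|_∞ ≥ |y − y′|_∞ − 1`. [folklore] -/
theorem edistR_ge_supNorm_blk {n : ℕ} (hn : 1 ≤ n) (R : Finset (Fin (d + 1) → ℤ)) (x t : ↥R) :
    supNorm (blk n x.1 - blk n t.1) - 1 ≤ edistR n R x t := by
  have hn0 : (0 : ℝ) < n := by exact_mod_cast hn
  have h := supNorm_blk_sub_blk_le hn x.1 t.1
  have hs := supNorm_nonneg (x.1 - t.1)
  have h2 : (supNorm (x.1 - t.1) + ((n : ℝ) - 1)) / n ≤ 1 / (n : ℝ) * supNorm (x.1 - t.1) + 1 := by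
    rw [div_le_iff₀ hn0]
    have h3 : (1 / (n : ℝ) * supNorm (x.1 - t.1) + 1) * n = supNorm (x.1 - t.1) + n := by
      field_simp
    rw [h3]
    linarith
  unfold edistR
  linarith

/-! ## §3  The oriented bond form dominates half the ordered-pair sum -/

/-- a sum over a union is at most the sum of the sums (nonnegative terms). [folklore] -/
theorem sum_union_le_add {ι : Type*} [DecidableEq ι] (A B : Finset ι) (f : ι → ℝ) (hf : ∀ i, 0 ≤ f i) :
    ∑ i ∈ A ∪ B, f i ≤ ∑ i ∈ A, f i + ∑ i ∈ B, f i := by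
  have h := Finset.sum_union_inter (s₁ := A) (s₂ := B) (f := f)
  have h0 : 0 ≤ ∑ i ∈ A ∩ B, f i := Finset.sum_nonneg fun i _ => hf i
  linarith

/-- **THE ORDERED-PAIR SUM IS AT MOST TWICE THE ORIENTED BOND FORM**:
`Σ_x Σ_{x′ ∈ S, x′ ∼ x}(v x − v x′)² ≤ 2·Σ_μ Σ_{z, z+e_μ ∈ S}(v(z+e_μ) − v z)²` (in fact equality: every bond is
counted twice on the left; the converse inequality is `B4Prop31Zero.dirS_extS_le_pairSum`). [folklore] -/
theorem pairSum_le_two_dirS (S : Finset (Fin (d + 1) → ℤ)) (v : ↥S → ℝ) :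
    (∑ x : ↥S, ∑ x' : ↥S, if x'.1 ∈ nbrs x.1 then (v x - v x') ^ 2 else 0) ≤ 2 * dirS S (extS S v) := by
  classical
  -- the `+e_μ` and `−e_μ` halves, written with `extS`
  set plus : ↥S → ℝ := fun x =>
    ∑ μ, if x.1 + uvec μ ∈ S then (extS S v (x.1 + uvec μ) - extS S v x.1) ^ 2 else 0 with hplus
  set minus : ↥S → ℝ := fun x =>
    ∑ μ, if x.1 - uvec μ ∈ S then (extS S v (x.1 - uvec μ) - extS S v x.1) ^ 2 else 0 with hminus
  -- (i) the `+` half sums to the bond form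
  have hdir : dirS S (extS S v)
      = ∑ μ, ∑ z ∈ S, if z + uvec μ ∈ S then (extS S v (z + uvec μ) - extS S v z) ^ 2 else 0 := by
    unfold dirS bset
    simp only [Finset.sum_filter]
  have hP : ∑ x : ↥S, plus x = dirS S (extS S v) := by
    calc ∑ x : ↥S, plus x
        = ∑ x ∈ S, ∑ μ, (if x + uvec μ ∈ S then (extS S v (x + uvec μ) - extS S v x) ^ 2 else 0) :=
          Finset.sum_coe_sort S
            (fun x => ∑ μ, (if x + uvec μ ∈ S then (extS S v (x + uvec μ) - extS S v x) ^ 2 else 0))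
      _ = ∑ μ, ∑ z ∈ S, (if z + uvec μ ∈ S then (extS S v (z + uvec μ) - extS S v z) ^ 2 else 0) :=
          Finset.sum_comm
      _ = dirS S (extS S v) := hdir.symm
  -- (ii) the `−` half sums to the bond form (reindex `z = x − e_μ`)
  have hre : ∀ μ : Fin (d + 1),
      (∑ x ∈ S, if x - uvec μ ∈ S then (extS S v (x - uvec μ) - extS S v x) ^ 2 else 0)
        = ∑ z ∈ S, if z + uvec μ ∈ S then (extS S v (z + uvec μ) - extS S v z) ^ 2 else 0 := by
    intro μ
    rw [← Finset.sum_filter, ← Finset.sum_filter]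
    refine Finset.sum_bij' (fun x _ => x - uvec μ) (fun z _ => z + uvec μ) ?_ ?_ ?_ ?_ ?_
    · intro x hx
      rw [Finset.mem_filter] at hx ⊢
      refine ⟨hx.2, ?_⟩
      rw [sub_add_cancel]
      exact hx.1
    · intro z hz
      rw [Finset.mem_filter] at hz ⊢
      refine ⟨hz.2, ?_⟩
      rw [add_sub_cancel_right]
      exact hz.1
    · intro x _
      exact sub_add_cancel x (uvec μ)
    · intro z _
      exact add_sub_cancel_right z (uvec μ)
    · intro x _
      rw [sub_add_cancel]
      ring
  have hM : ∑ x : ↥S, minus x = dirS S (extS S v) := by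
    calc ∑ x : ↥S, minus x
        = ∑ x ∈ S, ∑ μ, (if x - uvec μ ∈ S then (extS S v (x - uvec μ) - extS S v x) ^ 2 else 0) :=
          Finset.sum_coe_sort S
            (fun x => ∑ μ, (if x - uvec μ ∈ S then (extS S v (x - uvec μ) - extS S v x) ^ 2 else 0))
      _ = ∑ μ, ∑ x ∈ S, (if x - uvec μ ∈ S then (extS S v (x - uvec μ) - extS S v x) ^ 2 else 0) :=
          Finset.sum_comm
      _ = ∑ μ, ∑ z ∈ S, (if z + uvec μ ∈ S then (extS S v (z + uvec μ) - extS S v z) ^ 2 else 0) :=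
          Finset.sum_congr rfl fun μ _ => hre μ
      _ = dirS S (extS S v) := hdir.symm
  -- (iii) each inner sum is at most `plus x + minus x`
  have hx : ∀ x : ↥S, (∑ x' : ↥S, if x'.1 ∈ nbrs x.1 then (v x - v x') ^ 2 else 0) ≤ plus x + minus x := by
    intro x
    set F := Finset.univ.filter (fun x' : ↥S => x'.1 ∈ nbrs x.1) with hF
    set Pp := Finset.univ.filter (fun μ : Fin (d + 1) => x.1 + uvec μ ∈ S) with hPp
    set Pm := Finset.univ.filter (fun μ : Fin (d + 1) => x.1 - uvec μ ∈ S) with hPm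
    set fp : Fin (d + 1) → ↥S := fun μ => if h : x.1 + uvec μ ∈ S then ⟨x.1 + uvec μ, h⟩ else x with hfp
    set fm : Fin (d + 1) → ↥S := fun μ => if h : x.1 - uvec μ ∈ S then ⟨x.1 - uvec μ, h⟩ else x with hfm
    have hfpP : ∀ μ ∈ Pp, (fp μ).1 = x.1 + uvec μ := by
      intro μ hμ
      have h := (Finset.mem_filter.1 hμ).2
      simp only [hfp, dif_pos h]
    have hfmP : ∀ μ ∈ Pm, (fm μ).1 = x.1 - uvec μ := by
      intro μ hμ
      have h := (Finset.mem_filter.1 hμ).2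
      simp only [hfm, dif_pos h]
    have hinjp : Set.InjOn fp ↑Pp := by
      intro μ hμ ν hν h
      have h' := congrArg Subtype.val h
      rw [hfpP μ hμ, hfpP ν hν] at h'
      exact uvec_injective (add_left_cancel h')
    have hinjm : Set.InjOn fm ↑Pm := by
      intro μ hμ ν hν h
      have h' := congrArg Subtype.val h
      rw [hfmP μ hμ, hfmP ν hν] at h'
      exact uvec_injective (sub_right_injective h')
    have hsub : F ⊆ Pp.image fp ∪ Pm.image fm := by
      intro x' hx'
      have hnb : x'.1 ∈ nbrs x.1 := (Finset.mem_filter.1 hx').2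
      obtain ⟨μ, h | h⟩ := mem_nbrs.1 hnb
      · have hmem : x.1 + uvec μ ∈ S := by
          have : x.1 + uvec μ = x'.1 := by rw [h]; rfl
          rw [this]; exact x'.2
        refine Finset.mem_union_left _ (Finset.mem_image.2 ⟨μ, Finset.mem_filter.2 ⟨Finset.mem_univ _, hmem⟩, ?_⟩)
        apply Subtype.ext
        rw [hfpP μ (Finset.mem_filter.2 ⟨Finset.mem_univ _, hmem⟩), h]
        rfl
      · have hmem : x.1 - uvec μ ∈ S := by
          have : x.1 - uvec μ = x'.1 := by rw [h]; rfl
          rw [this]; exact x'.2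
        refine Finset.mem_union_right _ (Finset.mem_image.2 ⟨μ, Finset.mem_filter.2 ⟨Finset.mem_univ _, hmem⟩, ?_⟩)
        apply Subtype.ext
        rw [hfmP μ (Finset.mem_filter.2 ⟨Finset.mem_univ _, hmem⟩), h]
        rfl
    have hplusx : plus x = ∑ x' ∈ Pp.image fp, (v x - v x') ^ 2 := by
      rw [Finset.sum_image hinjp, hplus]
      simp only
      rw [hPp, Finset.sum_filter]
      refine Finset.sum_congr rfl fun μ _ => ?_
      split_ifs with h
      · rw [extS_of_mem v h, extS_coe]
        simp only [hfp, dif_pos h]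
        ring
      · rfl
    have hminusx : minus x = ∑ x' ∈ Pm.image fm, (v x - v x') ^ 2 := by
      rw [Finset.sum_image hinjm, hminus]
      simp only
      rw [hPm, Finset.sum_filter]
      refine Finset.sum_congr rfl fun μ _ => ?_
      split_ifs with h
      · rw [extS_of_mem v h, extS_coe]
        simp only [hfm, dif_pos h]
        ring
      · rfl
    calc (∑ x' : ↥S, if x'.1 ∈ nbrs x.1 then (v x - v x') ^ 2 else 0)
        = ∑ x' ∈ F, (v x - v x') ^ 2 := by rw [hF, Finset.sum_filter]
      _ ≤ ∑ x' ∈ Pp.image fp ∪ Pm.image fm, (v x - v x') ^ 2 :=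
          Finset.sum_le_sum_of_subset_of_nonneg hsub fun _ _ _ => sq_nonneg _
      _ ≤ ∑ x' ∈ Pp.image fp, (v x - v x') ^ 2 + ∑ x' ∈ Pm.image fm, (v x - v x') ^ 2 :=
          sum_union_le_add _ _ _ fun _ => sq_nonneg _
      _ = plus x + minus x := by rw [hplusx, hminusx]
  calc (∑ x : ↥S, ∑ x' : ↥S, if x'.1 ∈ nbrs x.1 then (v x - v x') ^ 2 else 0)
      ≤ ∑ x : ↥S, (plus x + minus x) := Finset.sum_le_sum fun x _ => hx x
    _ = 2 * dirS S (extS S v) := by rw [Finset.sum_add_distrib, hP, hM]; ring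

/-! ## §4  The covariance operator `Δ^{(k)}(Ω, 0) + aL^{-2}P(0)` of a region and its quadratic form (1.15) -/

/-- **THE `L`-BLOCK AVERAGING PROJECTION `P(A)` AT `A = 0`** on a finite set `Ω^{(k)}` of unit sites:
`P(0)(y, y′) = L^{-(d+1)}·[y, y′ in the same L-block]` (the orthogonal projection onto functions constant on
`L`-blocks when `Ω^{(k)}` is a union of `L`-blocks; `B4BoxCov237.blockAvgP` is the case of a box).
[cite: Balaban1983RegularityDecay, p. 574 (1.15) («P(A)»), dictionary] [folklore] -/
def projL (L : ℕ) (Ω : Finset (Fin (d + 1) → ℤ)) : Matrix ↥Ω ↥Ω ℝ :=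
  Matrix.of fun y y' => if blk L y'.1 = blk L y.1 then ((L : ℝ) ^ (d + 1))⁻¹ else 0

/-- the entries of `P(0)`. [folklore] -/
theorem projL_apply (L : ℕ) (Ω : Finset (Fin (d + 1) → ℤ)) (y y' : ↥Ω) :
    projL L Ω y y' = if blk L y'.1 = blk L y.1 then ((L : ℝ) ^ (d + 1))⁻¹ else 0 := rfl

/-- the entries of `P(0)` as a sum of rank-one block terms. [folklore] -/
theorem projL_eq_sum (L : ℕ) (Ω : Finset (Fin (d + 1) → ℤ)) (y y' : ↥Ω) :
    projL L Ω y y' = ∑ b : ↥(Ω.image (blk L)), ((L : ℝ) ^ (d + 1))⁻¹ *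
      ((if rblk L Ω y = b then (1 : ℝ) else 0) * (if rblk L Ω y' = b then (1 : ℝ) else 0)) := by
  rw [sum_ind_mul_ind (fun _ => ((L : ℝ) ^ (d + 1))⁻¹) (rblk L Ω y) (rblk L Ω y'), projL_apply]
  have hblk : (rblk L Ω y' = rblk L Ω y) ↔ (blk L y'.1 = blk L y.1) := by
    simp only [rblk, Subtype.mk.injEq]
  simp only [hblk]

/-- `P(0)` is symmetric. [folklore] -/
theorem projL_isSymm (L : ℕ) (Ω : Finset (Fin (d + 1) → ℤ)) : (projL L Ω).IsSymm := by
  ext y y'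
  simp only [Matrix.transpose_apply, projL_apply]
  by_cases h : blk L y'.1 = blk L y.1
  · rw [if_pos h, if_pos h.symm]
  · rw [if_neg h, if_neg (fun h' => h h'.symm)]

/-- the quadratic form of `P(0)`: `ψ ⬝ P(0)ψ = L^{-(d+1)}·Σ_b (Σ_{y ∈ b} ψ y)²`. [folklore] -/
theorem projL_form (L : ℕ) (Ω : Finset (Fin (d + 1) → ℤ)) (ψ : ↥Ω → ℝ) :
    ψ ⬝ᵥ (projL L Ω).mulVec ψ = ((L : ℝ) ^ (d + 1))⁻¹ *
      ∑ b : ↥(Ω.image (blk L)), (∑ i ∈ Finset.univ.filter (fun i => rblk L Ω i = b), ψ i) ^ 2 := by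
  have h := Beta.BlockPoincare.quadForm_rankOne_sum (fun _ : ↥(Ω.image (blk L)) => ((L : ℝ) ^ (d + 1))⁻¹)
    (fun b i => if rblk L Ω i = b then (1 : ℝ) else 0) ψ
  have hL : ψ ⬝ᵥ (projL L Ω).mulVec ψ = ∑ j, ψ j * ∑ k, (∑ b : ↥(Ω.image (blk L)), ((L : ℝ) ^ (d + 1))⁻¹ *
      ((if rblk L Ω j = b then (1 : ℝ) else 0) * (if rblk L Ω k = b then (1 : ℝ) else 0))) * ψ k := by
    simp only [Matrix.mulVec, dotProduct, projL_eq_sum]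
  rw [hL, h, Finset.mul_sum]
  refine Finset.sum_congr rfl fun b _ => ?_
  congr 1
  rw [Finset.sum_filter]
  congr 1
  exact Finset.sum_congr rfl fun i _ => by rw [boole_mul]

/-- `ψ ⬝ P(0)ψ ≤ ‖ψ‖²` on a union of `L`-blocks (Jensen on each block of `L^{d+1}` sites). [folklore] -/
theorem projL_form_le {L : ℕ} (hL : 1 ≤ L) {Ω : Finset (Fin (d + 1) → ℤ)} (hΩ : IsBlockUnion L Ω)
    (ψ : ↥Ω → ℝ) : ψ ⬝ᵥ (projL L Ω).mulVec ψ ≤ ψ ⬝ᵥ ψ := by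
  have hL0 : (0 : ℝ) < L := by exact_mod_cast hL
  rw [projL_form]
  have hcard : ∀ b : ↥(Ω.image (blk L)),
      ((Finset.univ.filter fun i => rblk L Ω i = b).card : ℝ) = (L : ℝ) ^ (d + 1) := by
    intro b
    rw [card_filter_rblk hL hΩ b]
    push_cast
    rfl
  have h1 : ∀ b : ↥(Ω.image (blk L)),
      (∑ i ∈ Finset.univ.filter (fun i => rblk L Ω i = b), ψ i) ^ 2
        ≤ (L : ℝ) ^ (d + 1) * ∑ i ∈ Finset.univ.filter (fun i => rblk L Ω i = b), ψ i ^ 2 := by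
    intro b
    have hcs := sq_sum_le_card_mul_sum_sq (s := Finset.univ.filter (fun i => rblk L Ω i = b)) (f := ψ)
    rwa [hcard b] at hcs
  have h2 : ∑ b : ↥(Ω.image (blk L)), ∑ i ∈ Finset.univ.filter (fun i => rblk L Ω i = b), ψ i ^ 2
      = ∑ i, ψ i ^ 2 := Finset.sum_fiberwise Finset.univ (rblk L Ω) (fun i => ψ i ^ 2)
  have hpow : ((L : ℝ) ^ (d + 1)) ≠ 0 := by positivity
  calc ((L : ℝ) ^ (d + 1))⁻¹ *
        ∑ b : ↥(Ω.image (blk L)), (∑ i ∈ Finset.univ.filter (fun i => rblk L Ω i = b), ψ i) ^ 2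
      ≤ ((L : ℝ) ^ (d + 1))⁻¹ * ∑ b : ↥(Ω.image (blk L)),
          ((L : ℝ) ^ (d + 1) * ∑ i ∈ Finset.univ.filter (fun i => rblk L Ω i = b), ψ i ^ 2) :=
        mul_le_mul_of_nonneg_left (Finset.sum_le_sum fun b _ => h1 b) (by positivity)
    _ = ∑ i, ψ i ^ 2 := by
        rw [← Finset.mul_sum, ← mul_assoc, inv_mul_cancel₀ hpow, one_mul, h2]
    _ = ψ ⬝ᵥ ψ := by
        unfold dotProduct
        exact Finset.sum_congr rfl fun i _ => sq (ψ i)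

/-- **THE COVARIANCE OPERATOR OF PROPOSITION 2.3 AT `A = 0` ON A REGION**:
`Δ^{(k)}(Ω, 0) + a L^{-2}P(0)` on `ℓ²(Ω^{(k)})` — `B4Prop31Zero.KeffR` (= `a_k I − a_k²Q_kG_k(Ω,0)Q_k^*`, (1.14) at
`A = 0`, for an ARBITRARY finite `Ω^{(k)}`) plus `aL^{-2}·projL` (`B4BoxCov237.covOp` is the case `Ω` = a box).
[cite: Balaban1983RegularityDecay, p. 573 (1.13)–(1.14) and p. 574 (1.15), case A = 0, dictionary] [folklore] -/
def covR (n L : ℕ) (a₁ a₂ m2 : ℝ) (Ω : Finset (Fin (d + 1) → ℤ)) : Matrix ↥Ω ↥Ω ℝ :=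
  KeffR n a₁ m2 Ω + (a₂ / (L : ℝ) ^ 2) • projL L Ω

/-- the covariance operator is symmetric. [folklore] -/
theorem covR_isSymm (n L : ℕ) (a₁ a₂ m2 : ℝ) (Ω : Finset (Fin (d + 1) → ℤ)) :
    (covR n L a₁ a₂ m2 Ω).IsSymm :=
  (KeffR_isSymm n a₁ m2 Ω).add ((projL_isSymm L Ω).smul _)

/-- the quadratic form splits. [folklore] -/
theorem covR_form_eq (n L : ℕ) (a₁ a₂ m2 : ℝ) (Ω : Finset (Fin (d + 1) → ℤ)) (ψ : ↥Ω → ℝ) :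
    ψ ⬝ᵥ (covR n L a₁ a₂ m2 Ω).mulVec ψ
      = ψ ⬝ᵥ (KeffR n a₁ m2 Ω).mulVec ψ + a₂ / (L : ℝ) ^ 2 * (ψ ⬝ᵥ (projL L Ω).mulVec ψ) := by
  simp only [covR, Matrix.add_mulVec, Matrix.smul_mulVec, dotProduct_add, dotProduct_smul, smul_eq_mul]

/-- **B4 (1.15) AT `A = 0`, LOWER BOUND, EVERY FINITE UNION `Ω^{(k)}` OF `L`-BLOCKS, EVERY MESH, EXPLICIT CONSTANT**:
`⟨ψ, (Δ^{(k)}(Ω,0) + aL^{-2}P(0))ψ⟩ ≥ min(a_k/(8(d+1)+2m²), 1/8)·min(2,a)·L^{-2}·‖ψ‖²`.  Mechanism (the print's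
«we apply Proposition II.3.1′ … the Laplace operator with Neumann boundary conditions for each block plus the
projection operator on constant functions … is bounded from below by … γ₀min{π²L^{-2}, aL^{-2}}», p. 593 (5.2)–(5.3),
at `A = 0`): (1.22) at `A = 0` (`B4Prop31Zero.KeffR_form_ge`) bounds the first operator below by `γ₀` times the
unit bond form of `Ω^{(k)}`; the bond form plus `aL^{-2}P(0)` is `L^{-2}` times the operator (1.6) of the UNIT
lattice with mesh parameter `L` on the block union `Ω^{(k)}` (`pairSum_le_two_dirS`, `B4Lower18.fineOpR_form`),
which is `≥ min(2, a)` by (1.8) at `A = 0` (`B4Lower18.lower18_zero`).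
[cite: Balaban1983RegularityDecay, p. 574 (1.15) with p. 593 (5.1)–(5.3), case A = 0 (constant and proof the
package's)] -/
theorem covR_form_ge {n L : ℕ} (hn : 1 ≤ n) (hL : 1 ≤ L) {a₁ a₂ m2 : ℝ} (ha : 0 < a₁) (ha2 : 0 ≤ a₂)
    (hm : 0 ≤ m2) {Ω : Finset (Fin (d + 1) → ℤ)} (hΩ : IsBlockUnion L Ω) (ψ : ↥Ω → ℝ) :
    min (a₁ / (8 * (d + 1) + 2 * m2)) (1 / 8) * (min 2 a₂ / (L : ℝ) ^ 2) * (ψ ⬝ᵥ ψ)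
      ≤ ψ ⬝ᵥ (covR n L a₁ a₂ m2 Ω).mulVec ψ := by
  have hL0 : (0 : ℝ) < L := by exact_mod_cast hL
  set γ₀ : ℝ := min (a₁ / (8 * (d + 1) + 2 * m2)) (1 / 8) with hγ₀
  have hγ₀0 : 0 < γ₀ := lt_min (by positivity) (by norm_num)
  have hγ₀1 : γ₀ ≤ 1 := (min_le_right _ _).trans (by norm_num)
  set X : ℝ := (L : ℝ) ^ 2 with hX
  have hX0 : 0 < X := by positivity
  set D : ℝ := dirS Ω (extS Ω ψ) with hD
  set B : ℝ := ∑ b : ↥(Ω.image (blk L)), (∑ i ∈ Finset.univ.filter (fun i => rblk L Ω i = b), ψ i) ^ 2 with hB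
  set Ninv : ℝ := ((L : ℝ) ^ (d + 1))⁻¹ with hNinv
  have hψψ : 0 ≤ ψ ⬝ᵥ ψ := by
    unfold dotProduct
    exact Finset.sum_nonneg fun i _ => mul_self_nonneg _
  have hD0 : 0 ≤ D := dirS_nonneg _ _
  have hB0 : 0 ≤ B := Finset.sum_nonneg fun b _ => sq_nonneg _
  have hNinv0 : 0 ≤ Ninv := by positivity
  have hK := KeffR_form_ge hn ha hm Ω ψ
  have hP := projL_form L Ω ψ
  have h18 := lower18_zero hL ha2 hΩ ψ
  have hform := fineOpR_form hL hΩ a₂ 0 ψ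
  have hpair := pairSum_le_two_dirS Ω ψ
  -- step 1: `min(2,a₂)‖ψ‖² ≤ L²·D + a₂·L^{-(d+1)}·B`
  have step1 : min 2 a₂ * (ψ ⬝ᵥ ψ) ≤ X * D + a₂ * Ninv * B := by
    rw [hform] at h18
    have hh : (L : ℝ) ^ 2 / 2 * (∑ x : ↥Ω, ∑ x' : ↥Ω, if x'.1 ∈ nbrs x.1 then (ψ x - ψ x') ^ 2 else 0)
        ≤ X * D := by
      rw [hX, hD]
      nlinarith [hpair, sq_nonneg (L : ℝ)]
    linarith
  -- step 2: `γ₀·D ≤ ψ ⬝ Δ^{(k)}(Ω,0)ψ`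
  have step2 : γ₀ * D ≤ ψ ⬝ᵥ (KeffR n a₁ m2 Ω).mulVec ψ := by
    have : γ₀ * D ≤ γ₀ * (D + m2 * (ψ ⬝ᵥ ψ)) :=
      mul_le_mul_of_nonneg_left (le_add_of_nonneg_right (mul_nonneg hm hψψ)) hγ₀0.le
    exact this.trans hK
  rw [covR_form_eq, hP]
  calc γ₀ * (min 2 a₂ / X) * (ψ ⬝ᵥ ψ) = γ₀ / X * (min 2 a₂ * (ψ ⬝ᵥ ψ)) := by
        field_simp
    _ ≤ γ₀ / X * (X * D + a₂ * Ninv * B) := mul_le_mul_of_nonneg_left step1 (by positivity)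
    _ = γ₀ * D + γ₀ * (a₂ / X * (Ninv * B)) := by
        field_simp
    _ ≤ γ₀ * D + 1 * (a₂ / X * (Ninv * B)) := by
        have h0 : 0 ≤ a₂ / X * (Ninv * B) := by positivity
        nlinarith
    _ ≤ ψ ⬝ᵥ (KeffR n a₁ m2 Ω).mulVec ψ + a₂ / X * (Ninv * B) := by linarith

/-- **B4 (1.15) AT `A = 0`, UPPER BOUND**: `⟨ψ, (Δ^{(k)}(Ω,0) + aL^{-2}P(0))ψ⟩ ≤ (a_k + aL^{-2})‖ψ‖²` (the print's
«the upper bound is quite elementary because Δ^{(k)}(Ω,A) + aL^{-2}P(A) = a_kI − a_k²Q_k(A)G_k(Ω,A)Q_k^*(A) + aL^{-2}P(A)»,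
p. 593 (5.1)): `B4Prop31Zero.KeffR_form_le` and `projL_form_le`.
[cite: Balaban1983RegularityDecay, p. 574 (1.15) with p. 593 (5.1), case A = 0] -/
theorem covR_form_le {n L : ℕ} (hn : 1 ≤ n) (hL : 1 ≤ L) {a₁ a₂ m2 : ℝ} (ha : 0 < a₁) (ha2 : 0 ≤ a₂)
    (hm : 0 ≤ m2) {Ω : Finset (Fin (d + 1) → ℤ)} (hΩ : IsBlockUnion L Ω) (ψ : ↥Ω → ℝ) :
    ψ ⬝ᵥ (covR n L a₁ a₂ m2 Ω).mulVec ψ ≤ (a₁ + a₂ / (L : ℝ) ^ 2) * (ψ ⬝ᵥ ψ) := by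
  rw [covR_form_eq]
  have h1 := KeffR_form_le hn ha hm Ω ψ
  have h2 := projL_form_le hL hΩ ψ
  have h3 : a₂ / (L : ℝ) ^ 2 * (ψ ⬝ᵥ (projL L Ω).mulVec ψ) ≤ a₂ / (L : ℝ) ^ 2 * (ψ ⬝ᵥ ψ) :=
    mul_le_mul_of_nonneg_left h2 (by positivity)
  linarith

/-! ## §5  The entries of `Δ^{(k)}(Ω, 0) + aL^{-2}P(0)` decay exponentially (Combes–Thomas pairing) -/

/-- **BLOCK–BLOCK PAIRINGS OF `G_k(Ω, 0)` DECAY**, every finite `Ω^{(k)}`, every mesh, every `m² ≥ 0`: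
`|Σ_{x∈B(y)}Σ_{x′∈B(y′)}G(x, x′)| ≤ N·(2/min(2,a))·e^{δ}·e^{−δ|y − y′|_∞}` (`N = n^{d+1}`; `G` the lattice-unit
Green's function `(fineOpR)⁻¹`).  Mechanism: the pairing `⟨1_{B(y)}, G1_{B(y′)}⟩` is at most
`‖1_{B(y)}‖·‖1_{B(y)}G1_{B(y′)}‖` and the set-to-set bound of §1 applies with `dist_η(B(y), B(y′)) ≥ |y − y′|_∞ − 1`
(§2). [cite: CombesThomas1973, §II] [folklore] -/
theorem blockPairing_bound {n : ℕ} (hn : 1 ≤ n) {a m2 δ : ℝ} (ha : 0 < a) (hm : 0 ≤ m2) (hδ0 : 0 ≤ δ)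
    (hδ1 : δ ≤ 1) (hsmall : 2 * ((d : ℝ) + 1) * δ ^ 2 + a * (Real.exp δ - 1) ≤ min 2 a / 2)
    (Ω : Finset (Fin (d + 1) → ℤ)) (y y' : ↥Ω) :
    |(indR n Ω * (fineOpR n a m2 (fineDom n Ω))⁻¹ * (indR n Ω)ᵀ) y y'|
      ≤ (n : ℝ) ^ (d + 1) * (2 / min 2 a) * Real.exp δ * Real.exp (-(δ * supNorm (y.1 - y'.1))) := by
  classical
  have hσ : 0 < min 2 a := lt_min (by norm_num) ha
  set R := fineDom n Ω with hR
  set G := (fineOpR n a m2 R)⁻¹ with hG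
  set g : ↥R → ℝ := fun x' => indR n Ω y' x' with hg
  set v : ↥R → ℝ := G.mulVec g with hv
  set S := Finset.univ.filter (fun x : ↥R => blk n x.1 = y.1) with hS
  set T := Finset.univ.filter (fun x : ↥R => blk n x.1 = y'.1) with hT
  set N : ℝ := (n : ℝ) ^ (d + 1) with hN
  have hn0 : (0 : ℝ) < n := by exact_mod_cast hn
  have hN0 : 0 < N := by positivity
  set s : ℝ := supNorm (y.1 - y'.1) with hs
  -- the entry is the sum of `v` over the block `S`
  have hentry : (indR n Ω * G * (indR n Ω)ᵀ) y y' = ∑ x ∈ S, v x := by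
    have h1 : (indR n Ω * G * (indR n Ω)ᵀ) y y' = ∑ x, indR n Ω y x * v x := by
      simp only [Matrix.mul_apply, Matrix.transpose_apply, Finset.sum_mul]
      rw [Finset.sum_comm]
      refine Finset.sum_congr rfl fun x _ => ?_
      simp only [hv, Matrix.mulVec, dotProduct, hg, Finset.mul_sum]
      exact Finset.sum_congr rfl fun x' _ => by ring
    rw [h1, hS, Finset.sum_filter]
    refine Finset.sum_congr rfl fun x _ => ?_
    simp only [indR, Matrix.of_apply, boole_mul]
  -- support of the source, nonempty target block
  have hg_supp : ∀ x, x ∉ T → g x = 0 := by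
    intro x hx
    have hx' : ¬ blk n x.1 = y'.1 := by simpa [hT] using hx
    simp [hg, indR, hx']
  have hT_ne : T.Nonempty := by
    refine ⟨⟨finePt n y'.1 (fun _ => ⟨0, by omega⟩), finePt_mem_fineDom hn y'.2 _⟩, ?_⟩
    simp [hT, blk_finePt hn]
  have hρ : ∀ x ∈ S, ∀ t ∈ T, s - 1 ≤ edistR n R x t := by
    intro x hx t ht
    have hx' : blk n x.1 = y.1 := (Finset.mem_filter.1 hx).2
    have ht' : blk n t.1 = y'.1 := (Finset.mem_filter.1 ht).2
    have h := edistR_ge_supNorm_blk hn R x t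
    rwa [hx', ht'] at h
  have hdec := green_setDecay_region_mass hn (fineDom_isBlockUnion hn Ω) ha hm hδ0 hδ1 hsmall S T hT_ne
    (s - 1) hρ g hg_supp
  -- `Σ g² = |T| = N`, `|S| = N`
  have hg2 : ∑ x, g x ^ 2 = N := by
    have h1 : ∀ x : ↥R, g x ^ 2 = if blk n x.1 = y'.1 then (1 : ℝ) else 0 := by
      intro x
      simp only [hg, indR, Matrix.of_apply]
      split_ifs <;> simp
    simp_rw [h1]
    rw [Finset.sum_boole]
    have : ((Finset.univ.filter (fun x : ↥R => blk n x.1 = y'.1)).card : ℝ) = N := by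
      rw [hN, hR, card_filter_blkR hn Ω y']
      push_cast
      rfl
    simpa using this
  have hScard : (S.card : ℝ) = N := by
    rw [hS, hN, hR, card_filter_blkR hn Ω y]
    push_cast
    rfl
  have hexp : Real.exp (-(2 * (δ * (s - 1)))) = (Real.exp δ * Real.exp (-(δ * s))) ^ 2 := by
    rw [← Real.exp_add, sq, ← Real.exp_add]
    congr 1
    ring
  have hcs := sq_sum_le_card_mul_sum_sq (s := S) (f := v)
  have hsq : (∑ x ∈ S, v x) ^ 2 ≤ (N * (2 / min 2 a) * Real.exp δ * Real.exp (-(δ * s))) ^ 2 := by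
    calc (∑ x ∈ S, v x) ^ 2 ≤ (S.card : ℝ) * ∑ x ∈ S, v x ^ 2 := hcs
      _ ≤ N * ((2 / min 2 a) ^ 2 * Real.exp (-(2 * (δ * (s - 1)))) * N) := by
          rw [hScard, ← hg2]
          exact mul_le_mul_of_nonneg_left hdec (by positivity)
      _ = (N * (2 / min 2 a) * Real.exp δ * Real.exp (-(δ * s))) ^ 2 := by
          rw [hexp]
          ring
  rw [hentry]
  exact abs_le_of_sq_le_sq hsq (by positivity)

/-- **THE ENTRIES OF `Δ^{(k)}(Ω, 0)` DECAY**, every finite `Ω^{(k)}`, every mesh: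
`|Δ^{(k)}(Ω,0)(y, y′)| ≤ (a_k + a_k²(2/min(2,a_k))e^{δ})·e^{−δ|y − y′|_∞}` for every admissible `δ`.
[cite: CombesThomas1973, §II] [folklore] -/
theorem KeffR_entry_decay {n : ℕ} (hn : 1 ≤ n) {a m2 δ : ℝ} (ha : 0 < a) (hm : 0 ≤ m2) (hδ0 : 0 ≤ δ)
    (hδ1 : δ ≤ 1) (hsmall : 2 * ((d : ℝ) + 1) * δ ^ 2 + a * (Real.exp δ - 1) ≤ min 2 a / 2)
    (Ω : Finset (Fin (d + 1) → ℤ)) (y y' : ↥Ω) :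
    |KeffR n a m2 Ω y y'| ≤ (a + a ^ 2 * (2 / min 2 a) * Real.exp δ) * Real.exp (-(δ * supNorm (y.1 - y'.1))) := by
  have hσ : 0 < min 2 a := lt_min (by norm_num) ha
  have hn0 : (0 : ℝ) < n := by exact_mod_cast hn
  have hG := blockPairing_bound hn ha hm hδ0 hδ1 hsmall Ω y y'
  have hentry : KeffR n a m2 Ω y y' = a * (if y = y' then (1 : ℝ) else 0)
      - a ^ 2 * ((n : ℝ) ^ (d + 1))⁻¹ * (indR n Ω * (fineOpR n a m2 (fineDom n Ω))⁻¹ * (indR n Ω)ᵀ) y y' := by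
    simp only [KeffR, Matrix.sub_apply, Matrix.smul_apply, Matrix.one_apply, smul_eq_mul]
  have h2 : |a ^ 2 * ((n : ℝ) ^ (d + 1))⁻¹ * (indR n Ω * (fineOpR n a m2 (fineDom n Ω))⁻¹ * (indR n Ω)ᵀ) y y'|
      ≤ a ^ 2 * (2 / min 2 a) * Real.exp δ * Real.exp (-(δ * supNorm (y.1 - y'.1))) := by
    rw [abs_mul, abs_of_nonneg (by positivity : (0 : ℝ) ≤ a ^ 2 * ((n : ℝ) ^ (d + 1))⁻¹)]
    have hN : (n : ℝ) ^ (d + 1) ≠ 0 := by positivity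
    calc a ^ 2 * ((n : ℝ) ^ (d + 1))⁻¹ * |(indR n Ω * (fineOpR n a m2 (fineDom n Ω))⁻¹ * (indR n Ω)ᵀ) y y'|
        ≤ a ^ 2 * ((n : ℝ) ^ (d + 1))⁻¹ * ((n : ℝ) ^ (d + 1) * (2 / min 2 a) * Real.exp δ
            * Real.exp (-(δ * supNorm (y.1 - y'.1)))) := mul_le_mul_of_nonneg_left hG (by positivity)
      _ = a ^ 2 * (2 / min 2 a) * Real.exp δ * Real.exp (-(δ * supNorm (y.1 - y'.1))) := by
          field_simp
  have h1 : |a * (if y = y' then (1 : ℝ) else 0)| ≤ a * Real.exp (-(δ * supNorm (y.1 - y'.1))) := by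
    by_cases hyy : y = y'
    · subst hyy
      rw [if_pos rfl, mul_one, abs_of_pos ha, sub_self, supNorm_zero', mul_zero, neg_zero, Real.exp_zero, mul_one]
    · rw [if_neg hyy, mul_zero, abs_zero]
      positivity
  rw [hentry]
  calc |a * (if y = y' then (1 : ℝ) else 0)
        - a ^ 2 * ((n : ℝ) ^ (d + 1))⁻¹ * (indR n Ω * (fineOpR n a m2 (fineDom n Ω))⁻¹ * (indR n Ω)ᵀ) y y'|
      ≤ |a * (if y = y' then (1 : ℝ) else 0)|
        + |a ^ 2 * ((n : ℝ) ^ (d + 1))⁻¹ * (indR n Ω * (fineOpR n a m2 (fineDom n Ω))⁻¹ * (indR n Ω)ᵀ) y y'| :=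
        abs_sub _ _
    _ ≤ a * Real.exp (-(δ * supNorm (y.1 - y'.1)))
        + a ^ 2 * (2 / min 2 a) * Real.exp δ * Real.exp (-(δ * supNorm (y.1 - y'.1))) := add_le_add h1 h2
    _ = (a + a ^ 2 * (2 / min 2 a) * Real.exp δ) * Real.exp (-(δ * supNorm (y.1 - y'.1))) := by ring

/-- the entries of `P(0)` against the decay profile: `|P(0)(y, y′)| ≤ e^{δ(L−1)}·e^{−δ|y − y′|_∞}` (`P(0)` vanishes
unless `y, y′` lie in one `L`-block, where `|y − y′|_∞ ≤ L − 1`). [folklore] -/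
theorem projL_entry_decay {L : ℕ} (hL : 1 ≤ L) (Ω : Finset (Fin (d + 1) → ℤ)) {δ : ℝ} (hδ : 0 ≤ δ)
    (y y' : ↥Ω) :
    |projL L Ω y y'| ≤ Real.exp (δ * ((L : ℝ) - 1)) * Real.exp (-(δ * supNorm (y.1 - y'.1))) := by
  rw [projL_apply]
  by_cases h : blk L y'.1 = blk L y.1
  · rw [if_pos h, abs_of_nonneg (by positivity)]
    have hs : supNorm (y.1 - y'.1) ≤ (L : ℝ) - 1 := supNorm_sub_le_of_blk_eq hL h.symm
    have hL1 : (1 : ℝ) ≤ (L : ℝ) ^ (d + 1) := one_le_pow₀ (by exact_mod_cast hL)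
    have h1 : ((L : ℝ) ^ (d + 1))⁻¹ ≤ 1 := inv_le_one_of_one_le₀ hL1
    have h2 : 1 ≤ Real.exp (δ * ((L : ℝ) - 1)) * Real.exp (-(δ * supNorm (y.1 - y'.1))) := by
      rw [← Real.exp_add]
      have h3 : 0 ≤ δ * ((L : ℝ) - 1) + -(δ * supNorm (y.1 - y'.1)) := by
        have := mul_le_mul_of_nonneg_left hs hδ
        linarith
      linarith [Real.add_one_le_exp (δ * ((L : ℝ) - 1) + -(δ * supNorm (y.1 - y'.1)))]
    linarith
  · rw [if_neg h, abs_zero]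
    positivity

/-- **THE ENTRIES OF `Δ^{(k)}(Ω,0) + aL^{-2}P(0)` DECAY**, every finite `Ω^{(k)}`, every mesh:
`|(Δ^{(k)}(Ω,0) + aL^{-2}P(0))(y, y′)| ≤ (a_k + a_k²(2/min(2,a_k))e^{δ} + aL^{-2}e^{δ(L−1)})·e^{−δ|y − y′|_∞}`.
[cite: CombesThomas1973, §II] [folklore] -/
theorem covR_entry_decay {n L : ℕ} (hn : 1 ≤ n) (hL : 1 ≤ L) {a₁ a₂ m2 δ : ℝ} (ha : 0 < a₁) (ha2 : 0 ≤ a₂)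
    (hm : 0 ≤ m2) (hδ0 : 0 ≤ δ) (hδ1 : δ ≤ 1)
    (hsmall : 2 * ((d : ℝ) + 1) * δ ^ 2 + a₁ * (Real.exp δ - 1) ≤ min 2 a₁ / 2)
    (Ω : Finset (Fin (d + 1) → ℤ)) (y y' : ↥Ω) :
    |covR n L a₁ a₂ m2 Ω y y'|
      ≤ (a₁ + a₁ ^ 2 * (2 / min 2 a₁) * Real.exp δ + a₂ / (L : ℝ) ^ 2 * Real.exp (δ * ((L : ℝ) - 1)))
          * Real.exp (-(δ * supNorm (y.1 - y'.1))) := by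
  have h1 := KeffR_entry_decay hn ha hm hδ0 hδ1 hsmall Ω y y'
  have h2 := projL_entry_decay hL Ω hδ0 y y'
  have hc : 0 ≤ a₂ / (L : ℝ) ^ 2 := by positivity
  have hentry : covR n L a₁ a₂ m2 Ω y y' = KeffR n a₁ m2 Ω y y' + a₂ / (L : ℝ) ^ 2 * projL L Ω y y' := by
    simp only [covR, Matrix.add_apply, Matrix.smul_apply, smul_eq_mul]
  rw [hentry]
  calc |KeffR n a₁ m2 Ω y y' + a₂ / (L : ℝ) ^ 2 * projL L Ω y y'|
      ≤ |KeffR n a₁ m2 Ω y y'| + |a₂ / (L : ℝ) ^ 2 * projL L Ω y y'| := abs_add_le _ _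
    _ = |KeffR n a₁ m2 Ω y y'| + a₂ / (L : ℝ) ^ 2 * |projL L Ω y y'| := by rw [abs_mul, abs_of_nonneg hc]
    _ ≤ (a₁ + a₁ ^ 2 * (2 / min 2 a₁) * Real.exp δ) * Real.exp (-(δ * supNorm (y.1 - y'.1)))
        + a₂ / (L : ℝ) ^ 2 * (Real.exp (δ * ((L : ℝ) - 1)) * Real.exp (-(δ * supNorm (y.1 - y'.1)))) :=
        add_le_add h1 (mul_le_mul_of_nonneg_left h2 hc)
    _ = (a₁ + a₁ ^ 2 * (2 / min 2 a₁) * Real.exp δ + a₂ / (L : ℝ) ^ 2 * Real.exp (δ * ((L : ℝ) - 1)))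
          * Real.exp (-(δ * supNorm (y.1 - y'.1))) := by ring


/-! ## §6  Condition (5.6) for `Δ^{(k)}(Ω,0) + aL^{-2}P(0)`, uniformly on the parameter window -/

/-- the sup-distance `|y − y′|_∞` of unit sites of `Ω^{(k)}` (the `|x − x′|` of (1.16), (1.18)).
[cite: Balaban1983RegularityDecay, p. 574 (1.16), dictionary] -/
def rhoS (Ω : Finset (Fin (d + 1) → ℤ)) (y y' : ↥Ω) : ℝ := supNorm (y.1 - y'.1)

/-- the sup-distance of unit sites is a pseudo-distance. [folklore] -/
theorem rhoS_isPseudoDist (Ω : Finset (Fin (d + 1) → ℤ)) : IsPseudoDist (rhoS Ω) where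
  symm := fun y y' => by
    unfold rhoS
    rw [← B4TorusKernel.supNorm_neg, neg_sub]
  zero := fun y => by
    unfold rhoS
    rw [sub_self]
    exact supNorm_zero'
  triangle := fun x y z => by
    unfold rhoS
    have := supNorm_add_le (x.1 - y.1) (y.1 - z.1)
    rwa [sub_add_sub_cancel] at this

/-- the uniform lattice-sum profile for the sup-distance on any finite set of unit sites. [folklore] -/
theorem rhoS_sumBound (Ω : Finset (Fin (d + 1) → ℤ)) : SumBound (rhoS Ω) (latticeConst (d + 1)) := by
  intro a ha y
  have h1 : ∀ y' : ↥Ω, Real.exp (-(a * rhoS Ω y y')) ≤ Real.exp (-(a * dist y.1 y'.1)) := by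
    intro y'
    apply Real.exp_le_exp.2
    have : dist y.1 y'.1 ≤ rhoS Ω y y' := by
      unfold rhoS
      rw [dist_pi_le_iff (supNorm_nonneg _)]
      intro i
      rw [Int.dist_eq]
      have := abs_le_supNorm (y.1 - y'.1) i
      rw [Pi.sub_apply] at this
      push_cast at this
      exact this
    nlinarith
  calc ∑ y', Real.exp (-(a * rhoS Ω y y'))
      ≤ ∑ y' : ↥Ω, Real.exp (-(a * dist y.1 y'.1)) := Finset.sum_le_sum fun y' _ => h1 y'
    _ = ∑ z ∈ Ω, Real.exp (-(a * dist y.1 z)) :=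
        Finset.sum_coe_sort Ω (fun z => Real.exp (-(a * dist y.1 z)))
    _ ≤ latticeConst (d + 1) a := latticeSum_le (d + 1) ha Ω y.1

/-- **THE COMBES–THOMAS RATE OF THE WINDOW**: `δ₀ = min(1, min(2, a₋)/(4(d+1) + 4|a₊|))`, admissible
(`2(d+1)δ₀² + a_k(e^{δ₀} − 1) ≤ min(2, a_k)/2`) for every `a_k ∈ [a₋, a₊]`. [folklore] -/
def ctRate (d : ℕ) (amin aplus : ℝ) : ℝ := min 1 (min 2 amin / (4 * ((d : ℝ) + 1) + 4 * |aplus|))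

/-- the rate is positive. [folklore] -/
theorem ctRate_pos (d : ℕ) {amin : ℝ} (aplus : ℝ) (ha : 0 < amin) : 0 < ctRate d amin aplus := by
  unfold ctRate
  have : 0 < min 2 amin := lt_min (by norm_num) ha
  exact lt_min one_pos (by positivity)

/-- the rate is at most one. [folklore] -/
theorem ctRate_le_one (d : ℕ) (amin aplus : ℝ) : ctRate d amin aplus ≤ 1 := min_le_left _ _

/-- the rate is admissible for the Combes–Thomas bound of §1 at every `a_k` of the window. [folklore] -/
theorem ctRate_small (d : ℕ) {amin aplus a : ℝ} (ha : 0 < amin) (h1 : amin ≤ a) (h2 : a ≤ aplus) :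
    2 * ((d : ℝ) + 1) * ctRate d amin aplus ^ 2 + a * (Real.exp (ctRate d amin aplus) - 1) ≤ min 2 a / 2 := by
  set δ := ctRate d amin aplus with hδ
  have hδ0 : 0 < δ := ctRate_pos d aplus ha
  have hδ1 : δ ≤ 1 := ctRate_le_one d amin aplus
  have hD : 0 < 4 * ((d : ℝ) + 1) + 4 * |aplus| := by positivity
  have hδle : δ ≤ min 2 amin / (4 * ((d : ℝ) + 1) + 4 * |aplus|) := min_le_right _ _
  have hδD : δ * (4 * ((d : ℝ) + 1) + 4 * |aplus|) ≤ min 2 amin := (le_div_iff₀ hD).1 hδle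
  have hexp : Real.exp δ - 1 ≤ 2 * δ := by
    have habs : |δ| ≤ 1 := by rw [abs_of_pos hδ0]; exact hδ1
    have h := Real.abs_exp_sub_one_le habs
    rw [abs_of_pos hδ0] at h
    exact (le_abs_self _).trans h
  have ha0 : 0 < a := lt_of_lt_of_le ha h1
  have haabs : a ≤ |aplus| := h2.trans (le_abs_self _)
  have hsq : δ ^ 2 ≤ δ := by nlinarith
  have hmin : min 2 amin ≤ min 2 a := min_le_min le_rfl h1
  have e1 : a * (Real.exp δ - 1) ≤ |aplus| * (2 * δ) := by
    calc a * (Real.exp δ - 1) ≤ a * (2 * δ) := mul_le_mul_of_nonneg_left hexp ha0.le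
      _ ≤ |aplus| * (2 * δ) := mul_le_mul_of_nonneg_right haabs (by positivity)
  have e2 : 2 * ((d : ℝ) + 1) * δ ^ 2 ≤ 2 * ((d : ℝ) + 1) * δ := mul_le_mul_of_nonneg_left hsq (by positivity)
  linarith

/-- **CONDITION (5.6) FOR `Δ^{(k)}(Ω,0) + aL^{-2}P(0)`, EVERY FINITE UNION `Ω^{(k)}` OF `L`-BLOCKS, UNIFORMLY ON THE
WINDOW** (the print's «Now … Δ^{(k)}(Ω, A) + aL^{-2}P(A) satisfy the condition (5.6)», p. 594, at `A = 0`): there are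
`γ₀ > 0`, `c₀ ≥ 0`, `κ > 0` depending on `d`, `ℓ` and the window only — explicitly
`γ₀ = min(a₋/(8(d+1)+2|m²₊|), 1/8)·min(2, a₂₋)/L²`, `κ = ctRate d a₋ a₊` — such that for every `n ≥ 1`, every
admissible `a_k, m², a` and EVERY finite union `Ω^{(k)}` of `L`-blocks the operator is symmetric, `≥ γ₀` as a form
and has entries `≤ c₀e^{−κ|y − y′|_∞}`. [cite: Balaban1983RegularityDecay, p. 594 (5.6) for the operator of (1.15),
case A = 0] -/
theorem covR_hyp56 (d ℓ : ℕ) (hℓ : 1 ≤ ℓ) (amin aplus m2max a2min a2plus : ℝ) (ha : 0 < amin)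
    (ha2 : 0 < a2min) :
    ∃ γ₀ c₀ κ : ℝ, 0 < γ₀ ∧ 0 ≤ c₀ ∧ 0 < κ ∧
      γ₀ = min (amin / (8 * (d + 1) + 2 * |m2max|)) (1 / 8) * (min 2 a2min / ((ℓ : ℝ) + 1) ^ 2) ∧
      κ = ctRate d amin aplus ∧
      ∀ (n : ℕ), 1 ≤ n → ∀ (a₁ m2 a₂ : ℝ), amin ≤ a₁ → a₁ ≤ aplus → 0 ≤ m2 →
        m2 ≤ m2max → a2min ≤ a₂ → a₂ ≤ a2plus → ∀ (Ω : Finset (Fin (d + 1) → ℤ)), IsBlockUnion (ℓ + 1) Ω →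
          Hyp56 (rhoS Ω) (covR n (ℓ + 1) a₁ a₂ m2 Ω) γ₀ c₀ κ := by
  set κ := ctRate d amin aplus with hκdef
  have hκ : 0 < κ := ctRate_pos d aplus ha
  have hκ1 : κ ≤ 1 := ctRate_le_one d amin aplus
  have hσ : 0 < min 2 amin := lt_min (by norm_num) ha
  have hσ2 : 0 < min 2 a2min := lt_min (by norm_num) ha2
  set γ₀ : ℝ := min (amin / (8 * (d + 1) + 2 * |m2max|)) (1 / 8) * (min 2 a2min / ((ℓ : ℝ) + 1) ^ 2) with hγ₀
  set c₀ : ℝ := |aplus| + aplus ^ 2 * (2 / min 2 amin) * Real.exp κ + |a2plus| * Real.exp (κ * ℓ) with hc₀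
  have hγ : 0 < γ₀ := mul_pos (lt_min (by positivity) (by norm_num)) (by positivity)
  have hc : 0 ≤ c₀ := by positivity
  refine ⟨γ₀, c₀, κ, hγ, hc, hκ, rfl, rfl, ?_⟩
  intro n hn a₁ m2 a₂ h1 h2 h3 h4 h5 h6 Ω hΩ
  have hL : 1 ≤ ℓ + 1 := by omega
  have ha₁ : 0 < a₁ := lt_of_lt_of_le ha h1
  have ha₂ : 0 ≤ a₂ := ha2.le.trans h5
  have hsmall := ctRate_small d ha h1 h2
  refine ⟨covR_isSymm n (ℓ + 1) a₁ a₂ m2 Ω, fun v => ?_, fun p q => ?_⟩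
  · have hge := covR_form_ge hn hL ha₁ ha₂ h3 hΩ v
    push_cast at hge
    have hγle : γ₀ ≤ min (a₁ / (8 * (d + 1) + 2 * m2)) (1 / 8) * (min 2 a₂ / ((ℓ : ℝ) + 1) ^ 2) := by
      refine mul_le_mul (min_le_min ?_ le_rfl) ?_ (by positivity) (le_min (by positivity) (by norm_num))
      · have hd1 : (0 : ℝ) < 8 * (d + 1) + 2 * m2 := by positivity
        calc amin / (8 * (d + 1) + 2 * |m2max|) ≤ amin / (8 * (d + 1) + 2 * m2) :=
            div_le_div_of_nonneg_left ha.le hd1 (by linarith [h4.trans (le_abs_self m2max)])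
          _ ≤ a₁ / (8 * (d + 1) + 2 * m2) := div_le_div_of_nonneg_right h1 hd1.le
      · exact div_le_div_of_nonneg_right (min_le_min le_rfl h5) (by positivity)
    have hvv : ∑ p, v p ^ 2 = v ⬝ᵥ v := by
      unfold dotProduct
      exact Finset.sum_congr rfl fun p _ => by ring
    have hvv0 : 0 ≤ v ⬝ᵥ v := by
      rw [← hvv]
      exact Finset.sum_nonneg fun _ _ => sq_nonneg _
    rw [hvv]
    show γ₀ * (v ⬝ᵥ v) ≤ v ⬝ᵥ (covR n (ℓ + 1) a₁ a₂ m2 Ω).mulVec v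
    exact (mul_le_mul_of_nonneg_right hγle hvv0).trans hge
  · unfold rhoS
    have hE := covR_entry_decay hn hL ha₁ ha₂ h3 hκ.le hκ1 hsmall Ω p q
    push_cast at hE
    simp only [add_sub_cancel_right] at hE
    have hX := Real.exp_pos (-(κ * supNorm (p.1 - q.1)))
    have hL2 : a₂ / ((ℓ : ℝ) + 1) ^ 2 ≤ |a2plus| :=
      calc a₂ / ((ℓ : ℝ) + 1) ^ 2 ≤ a₂ := div_le_self ha₂ (one_le_pow₀ (by linarith))
        _ ≤ a2plus := h6
        _ ≤ |a2plus| := le_abs_self _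
    have hK2 : a₁ + a₁ ^ 2 * (2 / min 2 a₁) * Real.exp κ ≤ |aplus| + aplus ^ 2 * (2 / min 2 amin) * Real.exp κ := by
      have hsq : a₁ ^ 2 ≤ aplus ^ 2 := pow_le_pow_left₀ ha₁.le h2 2
      have habs : a₁ ≤ |aplus| := h2.trans (le_abs_self _)
      have hσ₁ : 0 < min 2 a₁ := lt_min (by norm_num) ha₁
      have hdiv : 2 / min 2 a₁ ≤ 2 / min 2 amin :=
        div_le_div_of_nonneg_left (by norm_num) hσ (min_le_min le_rfl h1)
      have hprod : a₁ ^ 2 * (2 / min 2 a₁) ≤ aplus ^ 2 * (2 / min 2 amin) :=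
        mul_le_mul hsq hdiv (by positivity) (by positivity)
      have := mul_le_mul_of_nonneg_right hprod (Real.exp_pos κ).le
      linarith
    calc |covR n (ℓ + 1) a₁ a₂ m2 Ω p q|
        ≤ (a₁ + a₁ ^ 2 * (2 / min 2 a₁) * Real.exp κ + a₂ / ((ℓ : ℝ) + 1) ^ 2 * Real.exp (κ * ℓ))
            * Real.exp (-(κ * supNorm (p.1 - q.1))) := hE
      _ ≤ (|aplus| + aplus ^ 2 * (2 / min 2 amin) * Real.exp κ + |a2plus| * Real.exp (κ * ℓ))
            * Real.exp (-(κ * supNorm (p.1 - q.1))) := by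
          refine mul_le_mul_of_nonneg_right (add_le_add hK2 ?_) hX.le
          exact mul_le_mul_of_nonneg_right hL2 (by positivity)
      _ = c₀ * Real.exp (-(κ * supNorm (p.1 - q.1))) := by rw [hc₀]

/-! ## §7  Proposition 2.3 (1.15)–(1.18) at `A = 0` for every finite union `Ω^{(k)}` of `L`-blocks and every
`Λ ⊆ Ω^{(k)}` -/

/-- **B4 PROPOSITION 2.3 (1.15) AT `A = 0`, EVERY FINITE UNION `Ω^{(k)}` OF `L`-BLOCKS — HYPOTHESIS-FREE.**  For every
dimension `d + 1`, block size `L = ℓ + 1 ≥ 2` and parameter window there are `γ₀, γ₁ > 0` (explicitly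
`γ₀ = min(a₋/(8(d+1)+2|m²₊|), 1/8)·min(2,a₂₋)/L²`, `γ₁ = |a₊| + |a₂₊|`) such that for EVERY `n ≥ 1`
(`η = 1/n`; in the print `n = L^k`), every `a_k ∈ [a₋, a₊]`, `m² ∈ [0, m²₊]`, `a ∈ [a₂₋, a₂₊]` and EVERY finite
union `Ω^{(k)}` of `L`-blocks of unit sites (`Ω = B^k(Ω^{(k)})`):
`γ₀‖ψ‖² ≤ ⟨ψ, (Δ^{(k)}(Ω,0) + aL^{-2}P(0))ψ⟩ ≤ γ₁‖ψ‖²`.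
[cite: Balaban1983RegularityDecay, p. 574 Proposition 2.3 (1.15) («γ₀I ≤ Δ^{(k)}(Ω, A) + aL^{-2}P(A) ≤ γ₁I»),
case A = 0] -/
theorem cov115_region_form_bounds (d ℓ : ℕ) (hℓ : 1 ≤ ℓ) (amin aplus m2max a2min a2plus : ℝ) (ha : 0 < amin)
    (ha2 : 0 < a2min) :
    ∃ γ₀ γ₁ : ℝ, 0 < γ₀ ∧ 0 < γ₁ ∧
      γ₀ = min (amin / (8 * (d + 1) + 2 * |m2max|)) (1 / 8) * (min 2 a2min / ((ℓ : ℝ) + 1) ^ 2) ∧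
      ∀ (n : ℕ), 1 ≤ n → ∀ (a₁ m2 a₂ : ℝ), amin ≤ a₁ → a₁ ≤ aplus → 0 ≤ m2 →
        m2 ≤ m2max → a2min ≤ a₂ → a₂ ≤ a2plus → ∀ (Ω : Finset (Fin (d + 1) → ℤ)), IsBlockUnion (ℓ + 1) Ω →
          ∀ ψ : ↥Ω → ℝ,
            γ₀ * (ψ ⬝ᵥ ψ) ≤ ψ ⬝ᵥ (covR n (ℓ + 1) a₁ a₂ m2 Ω).mulVec ψ ∧
            ψ ⬝ᵥ (covR n (ℓ + 1) a₁ a₂ m2 Ω).mulVec ψ ≤ γ₁ * (ψ ⬝ᵥ ψ) := by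
  obtain ⟨γ₀, c₀, κ, hγ, -, -, hγ₀, -, hA⟩ := covR_hyp56 d ℓ hℓ amin aplus m2max a2min a2plus ha ha2
  refine ⟨γ₀, |aplus| + |a2plus| + 1, hγ, by positivity, hγ₀, ?_⟩
  intro n hn a₁ m2 a₂ h1 h2 h3 h4 h5 h6 Ω hΩ ψ
  have hL : 1 ≤ ℓ + 1 := by omega
  have ha₁ : 0 < a₁ := lt_of_lt_of_le ha h1
  have ha₂ : 0 ≤ a₂ := ha2.le.trans h5
  have hvv : ∑ p, ψ p ^ 2 = ψ ⬝ᵥ ψ := by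
    unfold dotProduct
    exact Finset.sum_congr rfl fun p _ => by ring
  have hvv0 : 0 ≤ ψ ⬝ᵥ ψ := by
    rw [← hvv]
    exact Finset.sum_nonneg fun _ _ => sq_nonneg _
  refine ⟨?_, ?_⟩
  · have h := (hA n hn a₁ m2 a₂ h1 h2 h3 h4 h5 h6 Ω hΩ).2.1 ψ
    rw [hvv] at h
    simpa [dotProduct] using h
  · have h := covR_form_le hn hL ha₁ ha₂ h3 hΩ ψ
    push_cast at h
    have hL2 : a₂ / ((ℓ : ℝ) + 1) ^ 2 ≤ |a2plus| :=
      calc a₂ / ((ℓ : ℝ) + 1) ^ 2 ≤ a₂ := div_le_self ha₂ (one_le_pow₀ (by linarith))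
        _ ≤ a2plus := h6
        _ ≤ |a2plus| := le_abs_self _
    have hK2 : a₁ ≤ |aplus| := h2.trans (le_abs_self _)
    have : (a₁ + a₂ / ((ℓ : ℝ) + 1) ^ 2) * (ψ ⬝ᵥ ψ) ≤ (|aplus| + |a2plus| + 1) * (ψ ⬝ᵥ ψ) :=
      mul_le_mul_of_nonneg_right (by linarith) hvv0
    exact h.trans this

/-- **THE COMPRESSION `Λ X Λ` OF `X = Δ^{(k)}(Ω,0) + aL^{-2}P(0)` TO A SUBSET `Λ ⊆ Ω^{(k)}`** (p. 573: «For arbitrary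
Λ ⊂ Ω^{(k)} = Ω∩Z^d, Λ being a sum of big blocks, let us define C_Λ^{(k)}(Ω, A) = (Δ^{(k)}(Ω, A) + aL^{-2}P(A))_Λ^{-1},
where the subscript Λ means a restriction to the set Λ, i.e. for arbitrary X we have X|_Λ = ΛXΛ», (1.13)), the
subset given as an injection `e : m → Ω^{(k)}`; its inverse is `C_Λ^{(k)}(Ω, 0)`.  No block structure of `Λ` is used
at `A = 0`. [cite: Balaban1983RegularityDecay, p. 573 (1.13), case A = 0, dictionary] -/
def covRSub (n L : ℕ) (a₁ a₂ m2 : ℝ) (Ω : Finset (Fin (d + 1) → ℤ)) {m : Type*} (e : m → ↥Ω) : Matrix m m ℝ :=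
  (covR n L a₁ a₂ m2 Ω).submatrix e e

/-- the compression along `e` has the entries `X(e i, e i′)`. [folklore] -/
@[simp] theorem covRSub_apply (n L : ℕ) (a₁ a₂ m2 : ℝ) (Ω : Finset (Fin (d + 1) → ℤ)) {m : Type*}
    (e : m → ↥Ω) (i i' : m) : covRSub n L a₁ a₂ m2 Ω e i i' = covR n L a₁ a₂ m2 Ω (e i) (e i') := rfl

/-- the compression along the identity is the operator itself (`Λ = Ω^{(k)}`). [folklore] -/
theorem covRSub_id (n L : ℕ) (a₁ a₂ m2 : ℝ) (Ω : Finset (Fin (d + 1) → ℤ)) :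
    covRSub n L a₁ a₂ m2 Ω (id : ↥Ω → ↥Ω) = covR n L a₁ a₂ m2 Ω := rfl

/-- **B4 PROPOSITION 2.3 (1.16) AT `A = 0`, EVERY FINITE UNION `Ω^{(k)}` OF `L`-BLOCKS AND EVERY `Λ ⊆ Ω^{(k)}` —
HYPOTHESIS-FREE.**  For every dimension `d + 1`, block size `L = ℓ + 1 ≥ 2` and parameter window there are
`δ₀, c₀ > 0` depending on `d`, `ℓ` and the window only such that for EVERY `n ≥ 1`, every admissible `a_k, m², a`,
EVERY finite union `Ω^{(k)}` of `L`-blocks and EVERY injection `e : m → Ω^{(k)}` (subset `Λ`): the compression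
`(Δ^{(k)}(Ω,0) + aL^{-2}P(0))|_Λ` is invertible (so `⁻¹` is the genuine inverse `C_Λ^{(k)}(Ω, 0)`) and
`|C_Λ^{(k)}(Ω, 0; e i, e i′)| ≤ c₀·e^{−δ₀|e i − e i′|_∞}` for all `i, i′`.  Mechanism: the general theorem of
Section 5 — an operator satisfying (5.6) has an exponentially decaying inverse on every subset
(`B4Sect5Torus.inv_submatrix_decay`, the print's Proposition 5.1/(5.7)) — applied to `covR_hyp56`.
[cite: Balaban1983RegularityDecay, p. 574 Proposition 2.3 (1.16) («|C_Λ^{(k)}(Ω, A; x, x′)| ≤ c₀ exp(−δ₀|x−x′|),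
x, x′∈Λ»), p. 573 (1.13), p. 594 (5.6)–(5.7), case A = 0] -/
theorem cov116_region_sub_decay (d ℓ : ℕ) (hℓ : 1 ≤ ℓ) (amin aplus m2max a2min a2plus : ℝ) (ha : 0 < amin)
    (ha2 : 0 < a2min) :
    ∃ δ c : ℝ, 0 < δ ∧ 0 < c ∧ ∀ (n : ℕ), 1 ≤ n → ∀ (a₁ m2 a₂ : ℝ), amin ≤ a₁ → a₁ ≤ aplus → 0 ≤ m2 →
      m2 ≤ m2max → a2min ≤ a₂ → a₂ ≤ a2plus → ∀ (Ω : Finset (Fin (d + 1) → ℤ)), IsBlockUnion (ℓ + 1) Ω →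
        ∀ {m : Type*} [Fintype m] [DecidableEq m] (e : m → ↥Ω), Function.Injective e →
          covRSub n (ℓ + 1) a₁ a₂ m2 Ω e * (covRSub n (ℓ + 1) a₁ a₂ m2 Ω e)⁻¹ = 1 ∧
          ∀ i i' : m, |(covRSub n (ℓ + 1) a₁ a₂ m2 Ω e)⁻¹ i i'|
            ≤ c * Real.exp (-(δ * supNorm ((e i).1 - (e i').1))) := by
  obtain ⟨γ₀, c₀, κ, hγ, hc, hκ, -, -, hA⟩ := covR_hyp56 d ℓ hℓ amin aplus m2max a2min a2plus ha ha2
  have hKn : ∀ a : ℝ, 0 < a → 0 ≤ latticeConst (d + 1) a := fun a ha => latticeConst_nonneg (d + 1) ha.le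
  refine ⟨rate (latticeConst (d + 1)) γ₀ c₀ κ, 2 / γ₀, rate_pos hKn hγ hc hκ, by positivity, ?_⟩
  intro n hn a₁ m2 a₂ h1 h2 h3 h4 h5 h6 Ω hΩ m _ _ e he
  have hAΩ := hA n hn a₁ m2 a₂ h1 h2 h3 h4 h5 h6 Ω hΩ
  have hAe := hyp56_submatrix hAΩ he
  refine ⟨Matrix.mul_nonsing_inv _ ((Matrix.isUnit_iff_isUnit_det _).1 (isUnit_of_hyp56 hγ hAe)), fun i i' => ?_⟩
  exact inv_submatrix_decay hKn hγ hc hκ (rhoS_isPseudoDist Ω) (rhoS_sumBound Ω) hAΩ he i i'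

/-- **(1.16) at `A = 0` for a subset `Λ ⊆ Ω^{(k)}` given as a `Finset` of unit sites** (the inclusion as the
injection): `Λ(Δ^{(k)}(Ω,0) + aL^{-2}P(0))Λ` is invertible on `ℓ²(Λ)` and `|C_Λ^{(k)}(Ω, 0; y, y′)| ≤ c₀·e^{−δ₀|y − y′|_∞}`
for all `y, y′ ∈ Λ`, with the constants of `cov116_region_sub_decay`.
[cite: Balaban1983RegularityDecay, p. 574 Proposition 2.3 (1.16), p. 573 (1.13), case A = 0] -/
theorem cov116_region_finset_decay (d ℓ : ℕ) (hℓ : 1 ≤ ℓ) (amin aplus m2max a2min a2plus : ℝ) (ha : 0 < amin)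
    (ha2 : 0 < a2min) :
    ∃ δ c : ℝ, 0 < δ ∧ 0 < c ∧ ∀ (n : ℕ), 1 ≤ n → ∀ (a₁ m2 a₂ : ℝ), amin ≤ a₁ → a₁ ≤ aplus → 0 ≤ m2 →
      m2 ≤ m2max → a2min ≤ a₂ → a₂ ≤ a2plus → ∀ (Ω : Finset (Fin (d + 1) → ℤ)), IsBlockUnion (ℓ + 1) Ω →
        ∀ Λ : Finset ↥Ω,
          covRSub n (ℓ + 1) a₁ a₂ m2 Ω (fun y : ↥Λ => y.1) * (covRSub n (ℓ + 1) a₁ a₂ m2 Ω (fun y : ↥Λ => y.1))⁻¹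
            = 1 ∧
          ∀ y y' : ↥Λ, |(covRSub n (ℓ + 1) a₁ a₂ m2 Ω (fun y : ↥Λ => y.1))⁻¹ y y'|
            ≤ c * Real.exp (-(δ * supNorm (y.1.1 - y'.1.1))) := by
  obtain ⟨δ, c, hδ, hc, h⟩ := cov116_region_sub_decay d ℓ hℓ amin aplus m2max a2min a2plus ha ha2
  refine ⟨δ, c, hδ, hc, ?_⟩
  intro n hn a₁ m2 a₂ h1 h2 h3 h4 h5 h6 Ω hΩ Λ
  exact h n hn a₁ m2 a₂ h1 h2 h3 h4 h5 h6 Ω hΩ (fun y : ↥Λ => y.1) Subtype.val_injective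

/-- **(1.16) at `A = 0` with `Λ = Ω^{(k)}`: `C^{(k)}(Ω, 0) = (Δ^{(k)}(Ω,0) + aL^{-2}P(0))^{-1}` exists and
`|C^{(k)}(Ω, 0; y, y′)| ≤ c₀·e^{−δ₀|y − y′|_∞}`** for every finite union `Ω^{(k)}` of `L`-blocks (the region analogue
of (2.37), `B4BoxCov237.cov237_box_decay`), with the constants of `cov116_region_sub_decay`.
[cite: Balaban1983RegularityDecay, p. 574 Proposition 2.3 (1.16) with Λ = Ω^{(k)}, case A = 0] -/
theorem cov116_region_decay (d ℓ : ℕ) (hℓ : 1 ≤ ℓ) (amin aplus m2max a2min a2plus : ℝ) (ha : 0 < amin)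
    (ha2 : 0 < a2min) :
    ∃ δ c : ℝ, 0 < δ ∧ 0 < c ∧ ∀ (n : ℕ), 1 ≤ n → ∀ (a₁ m2 a₂ : ℝ), amin ≤ a₁ → a₁ ≤ aplus → 0 ≤ m2 →
      m2 ≤ m2max → a2min ≤ a₂ → a₂ ≤ a2plus → ∀ (Ω : Finset (Fin (d + 1) → ℤ)), IsBlockUnion (ℓ + 1) Ω →
        covR n (ℓ + 1) a₁ a₂ m2 Ω * (covR n (ℓ + 1) a₁ a₂ m2 Ω)⁻¹ = 1 ∧
        ∀ y y' : ↥Ω, |(covR n (ℓ + 1) a₁ a₂ m2 Ω)⁻¹ y y'| ≤ c * Real.exp (-(δ * supNorm (y.1 - y'.1))) := by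
  obtain ⟨δ, c, hδ, hc, h⟩ := cov116_region_sub_decay d ℓ hℓ amin aplus m2max a2min a2plus ha ha2
  refine ⟨δ, c, hδ, hc, ?_⟩
  intro n hn a₁ m2 a₂ h1 h2 h3 h4 h5 h6 Ω hΩ
  exact h n hn a₁ m2 a₂ h1 h2 h3 h4 h5 h6 Ω hΩ (id : ↥Ω → ↥Ω) Function.injective_id

/-- **B4 PROPOSITION 2.3 (1.17)–(1.18) AT `A = 0`, EVERY FINITE UNION `Ω^{(k)}` OF `L`-BLOCKS AND EVERY
`Λ ⊆ Ω^{(k)}` — HYPOTHESIS-FREE.**  There are `δ′, c′ > 0` depending on `d`, `ℓ` and the window only such that for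
EVERY `n ≥ 1`, every admissible `a_k, m², a`, EVERY finite union `Ω^{(k)}` of `L`-blocks, EVERY injection
`e : m → Ω^{(k)}` (range `Λ`) and EVERY weight `β : m → ℝ` with `0 ≤ β i ≤ |e i − z|_∞` for all `z ∈ Ω^{(k)}` off the
range (e.g. `β = dist_∞(·, Ω^{(k)} ∖ Λ)`):
`|C_Λ^{(k)}(Ω, 0; e i, e i′) − C^{(k)}(Ω, 0; e i, e i′)| ≤ c′·e^{−δ′(|e i − e i′|_∞ + β i + β i′)}`.  Mechanism: the
block-resolvent identity and its decay under (5.6) (`B4Sect5Torus.deltaC_bound`, the print's (5.8)) applied to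
`covR_hyp56` (kernel constant enlarged to `c₀ + 1 > 0`).
[cite: Balaban1983RegularityDecay, p. 574 (1.17) («δC_Λ^{(k)}(Ω, A) = C_Λ^{(k)}(Ω, A) − C^{(k)}(Ω, A)»), (1.18)
(«|δC_Λ^{(k)}(Ω, A; x, x′)| ≤ c₀ exp(−δ₀(|x−x′| + dist(x, Λ^c) + dist(x′, Λ^c))), x, x′∈Λ»), p. 594 (5.8),
case A = 0] -/
theorem cov118_region_sub_delta (d ℓ : ℕ) (hℓ : 1 ≤ ℓ) (amin aplus m2max a2min a2plus : ℝ) (ha : 0 < amin)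
    (ha2 : 0 < a2min) :
    ∃ δ c : ℝ, 0 < δ ∧ 0 < c ∧ ∀ (n : ℕ), 1 ≤ n → ∀ (a₁ m2 a₂ : ℝ), amin ≤ a₁ → a₁ ≤ aplus → 0 ≤ m2 →
      m2 ≤ m2max → a2min ≤ a₂ → a₂ ≤ a2plus → ∀ (Ω : Finset (Fin (d + 1) → ℤ)), IsBlockUnion (ℓ + 1) Ω →
        ∀ {m : Type*} [Fintype m] [DecidableEq m] (e : m → ↥Ω), Function.Injective e →
          ∀ β : m → ℝ, (∀ i, 0 ≤ β i) → (∀ i (z : ↥Ω), (¬ ∃ j, e j = z) → β i ≤ supNorm ((e i).1 - z.1)) →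
            ∀ i i' : m,
              |(covRSub n (ℓ + 1) a₁ a₂ m2 Ω e)⁻¹ i i' - (covR n (ℓ + 1) a₁ a₂ m2 Ω)⁻¹ (e i) (e i')|
                ≤ c * Real.exp (-(δ * (supNorm ((e i).1 - (e i').1) + β i + β i'))) := by
  obtain ⟨γ₀, c₀, κ, hγ, hc, hκ, -, -, hA⟩ := covR_hyp56 d ℓ hℓ amin aplus m2max a2min a2plus ha ha2
  have hKn : ∀ a : ℝ, 0 < a → 0 ≤ latticeConst (d + 1) a := fun a ha => latticeConst_nonneg (d + 1) ha.le
  have hc1 : 0 < c₀ + 1 := by linarith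
  have hB := bigC_nonneg hKn hγ hc1.le hκ (K := latticeConst (d + 1))
  refine ⟨rate (latticeConst (d + 1)) γ₀ (c₀ + 1) κ / 4, bigC (latticeConst (d + 1)) γ₀ (c₀ + 1) κ + 1,
    by have := rate_pos hKn hγ hc1.le hκ; positivity, by positivity, ?_⟩
  intro n hn a₁ m2 a₂ h1 h2 h3 h4 h5 h6 Ω hΩ m _ _ e he β hβ0 hβ i i'
  have hA' := hyp56_mono (hA n hn a₁ m2 a₂ h1 h2 h3 h4 h5 h6 Ω hΩ) (by linarith : c₀ ≤ c₀ + 1)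
  have h := deltaC_bound hKn hγ hc1 hκ (rhoS_isPseudoDist Ω) (rhoS_sumBound Ω) hA' he hβ0
    (fun i z hz => by show β i ≤ supNorm ((e i).1 - z.1); exact hβ i z hz) i i'
  refine h.trans ?_
  exact mul_le_mul_of_nonneg_right (le_add_of_nonneg_right zero_le_one) (Real.exp_pos _).le

/-- `dist(y, Λ^c)` for `Λ ⊆ Ω^{(k)}`: the sup-distance from `y` to the complement of `Λ` INSIDE `Ω^{(k)}`
(`inf ∅ = 0` when `Λ = Ω^{(k)}`; `B4BoxCov237.distC` is the case of a box).
[cite: Balaban1983RegularityDecay, p. 574 (1.18) («dist(x, Λ^c)»), dictionary] -/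
def distCS {Ω : Finset (Fin (d + 1) → ℤ)} (Λ : Finset ↥Ω) (y : ↥Ω) : ℝ :=
  sInf ((fun z : ↥Ω => supNorm (y.1 - z.1)) '' {z | z ∉ Λ})

/-- `dist(y, Λ^c) ≥ 0`. [folklore] -/
theorem distCS_nonneg {Ω : Finset (Fin (d + 1) → ℤ)} (Λ : Finset ↥Ω) (y : ↥Ω) : 0 ≤ distCS Λ y := by
  unfold distCS
  apply Real.sInf_nonneg
  rintro _ ⟨z, -, rfl⟩
  exact supNorm_nonneg _

/-- `dist(y, Λ^c) ≤ |y − z|_∞` for every `z ∉ Λ`. [folklore] -/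
theorem distCS_le {Ω : Finset (Fin (d + 1) → ℤ)} (Λ : Finset ↥Ω) (y : ↥Ω) {z : ↥Ω} (hz : z ∉ Λ) :
    distCS Λ y ≤ supNorm (y.1 - z.1) := by
  unfold distCS
  exact csInf_le ⟨0, by rintro _ ⟨w, -, rfl⟩; exact supNorm_nonneg _⟩ ⟨z, hz, rfl⟩

/-- **(1.17)–(1.18) at `A = 0` for a subset `Λ ⊆ Ω^{(k)}` given as a `Finset` of unit sites**, with the printed weight
`dist(·, Λ^c)` (typed `distCS`, complement inside `Ω^{(k)}`):
`|C_Λ^{(k)}(Ω, 0; y, y′) − C^{(k)}(Ω, 0; y, y′)| ≤ c′·e^{−δ′(|y − y′|_∞ + dist(y, Λ^c) + dist(y′, Λ^c))}`, `y, y′ ∈ Λ`.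
[cite: Balaban1983RegularityDecay, p. 574 (1.17)–(1.18), case A = 0] -/
theorem cov118_region_finset_delta (d ℓ : ℕ) (hℓ : 1 ≤ ℓ) (amin aplus m2max a2min a2plus : ℝ) (ha : 0 < amin)
    (ha2 : 0 < a2min) :
    ∃ δ c : ℝ, 0 < δ ∧ 0 < c ∧ ∀ (n : ℕ), 1 ≤ n → ∀ (a₁ m2 a₂ : ℝ), amin ≤ a₁ → a₁ ≤ aplus → 0 ≤ m2 →
      m2 ≤ m2max → a2min ≤ a₂ → a₂ ≤ a2plus → ∀ (Ω : Finset (Fin (d + 1) → ℤ)), IsBlockUnion (ℓ + 1) Ω →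
        ∀ Λ : Finset ↥Ω, ∀ y y' : ↥Λ,
          |(covRSub n (ℓ + 1) a₁ a₂ m2 Ω (fun y : ↥Λ => y.1))⁻¹ y y' - (covR n (ℓ + 1) a₁ a₂ m2 Ω)⁻¹ y.1 y'.1|
            ≤ c * Real.exp (-(δ * (supNorm (y.1.1 - y'.1.1) + distCS Λ y.1 + distCS Λ y'.1))) := by
  obtain ⟨δ, c, hδ, hc, h⟩ := cov118_region_sub_delta d ℓ hℓ amin aplus m2max a2min a2plus ha ha2
  refine ⟨δ, c, hδ, hc, ?_⟩
  intro n hn a₁ m2 a₂ h1 h2 h3 h4 h5 h6 Ω hΩ Λ y y'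
  refine h n hn a₁ m2 a₂ h1 h2 h3 h4 h5 h6 Ω hΩ (fun y : ↥Λ => y.1) Subtype.val_injective
    (fun y : ↥Λ => distCS Λ y.1) (fun y => distCS_nonneg Λ y.1) (fun w z hz => distCS_le Λ w.1 ?_) y y'
  intro hzΛ
  exact hz ⟨⟨z, hzΛ⟩, rfl⟩

/-! ## §8  Non-vacuity: the hypotheses are met (`d + 1 = 4`, `L = 2`, window `a_k ∈ [1/2, 2]`, `m² ∈ [0, 1]`,
`a ∈ [1/2, 2]`), and the statements quantify over every finite union of `2`-blocks -/

/-- non-vacuity: (1.15) at `A = 0` for every finite union `Ω^{(k)} ⊂ ℤ⁴` of `2`-blocks. -/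
example : ∃ γ₀ γ₁ : ℝ, 0 < γ₀ ∧ 0 < γ₁ ∧
    γ₀ = min ((1 / 2 : ℝ) / (8 * (((3 : ℕ) : ℝ) + 1) + 2 * |(1 : ℝ)|)) (1 / 8)
      * (min 2 (1 / 2 : ℝ) / (((1 : ℕ) : ℝ) + 1) ^ 2) ∧
    ∀ (n : ℕ), 1 ≤ n → ∀ (a₁ m2 a₂ : ℝ), (1 / 2 : ℝ) ≤ a₁ → a₁ ≤ 2 → 0 ≤ m2 → m2 ≤ 1 → (1 / 2 : ℝ) ≤ a₂ →
      a₂ ≤ 2 → ∀ (Ω : Finset (Fin (3 + 1) → ℤ)), IsBlockUnion (1 + 1) Ω → ∀ ψ : ↥Ω → ℝ,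
        γ₀ * (ψ ⬝ᵥ ψ) ≤ ψ ⬝ᵥ (covR n (1 + 1) a₁ a₂ m2 Ω).mulVec ψ ∧
        ψ ⬝ᵥ (covR n (1 + 1) a₁ a₂ m2 Ω).mulVec ψ ≤ γ₁ * (ψ ⬝ᵥ ψ) :=
  cov115_region_form_bounds 3 1 le_rfl (1 / 2) 2 1 (1 / 2) 2 (by norm_num) (by norm_num)

/-- non-vacuity: (1.16) at `A = 0` for every `Finset` `Λ` of unit sites of every finite union `Ω^{(k)} ⊂ ℤ⁴` of
`2`-blocks. -/
example : ∃ δ c : ℝ, 0 < δ ∧ 0 < c ∧ ∀ (n : ℕ), 1 ≤ n → ∀ (a₁ m2 a₂ : ℝ), (1 / 2 : ℝ) ≤ a₁ → a₁ ≤ 2 → 0 ≤ m2 →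
    m2 ≤ 1 → (1 / 2 : ℝ) ≤ a₂ → a₂ ≤ 2 → ∀ (Ω : Finset (Fin (3 + 1) → ℤ)), IsBlockUnion (1 + 1) Ω →
      ∀ Λ : Finset ↥Ω,
        covRSub n (1 + 1) a₁ a₂ m2 Ω (fun y : ↥Λ => y.1) * (covRSub n (1 + 1) a₁ a₂ m2 Ω (fun y : ↥Λ => y.1))⁻¹
          = 1 ∧
        ∀ y y' : ↥Λ, |(covRSub n (1 + 1) a₁ a₂ m2 Ω (fun y : ↥Λ => y.1))⁻¹ y y'|
          ≤ c * Real.exp (-(δ * supNorm (y.1.1 - y'.1.1))) :=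
  cov116_region_finset_decay 3 1 le_rfl (1 / 2) 2 1 (1 / 2) 2 (by norm_num) (by norm_num)

/-- non-vacuity: (1.17)–(1.18) at `A = 0` for every `Finset` `Λ` of unit sites of every finite union `Ω^{(k)} ⊂ ℤ⁴`
of `2`-blocks. -/
example : ∃ δ c : ℝ, 0 < δ ∧ 0 < c ∧ ∀ (n : ℕ), 1 ≤ n → ∀ (a₁ m2 a₂ : ℝ), (1 / 2 : ℝ) ≤ a₁ → a₁ ≤ 2 → 0 ≤ m2 →
    m2 ≤ 1 → (1 / 2 : ℝ) ≤ a₂ → a₂ ≤ 2 → ∀ (Ω : Finset (Fin (3 + 1) → ℤ)), IsBlockUnion (1 + 1) Ω →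
      ∀ Λ : Finset ↥Ω, ∀ y y' : ↥Λ,
        |(covRSub n (1 + 1) a₁ a₂ m2 Ω (fun y : ↥Λ => y.1))⁻¹ y y' - (covR n (1 + 1) a₁ a₂ m2 Ω)⁻¹ y.1 y'.1|
          ≤ c * Real.exp (-(δ * (supNorm (y.1.1 - y'.1.1) + distCS Λ y.1 + distCS Λ y'.1))) :=
  cov118_region_finset_delta 3 1 le_rfl (1 / 2) 2 1 (1 / 2) 2 (by norm_num) (by norm_num)

/-- non-vacuity of the region quantifier beyond boxes: an `L`-shaped union of three `2`-blocks of `ℤ²` is a block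
union (and is not a rectangular parallelepiped). -/
example : IsBlockUnion 2 (fineDom 2 ({![0, 0], ![1, 0], ![0, 1]} : Finset (Fin (1 + 1) → ℤ))) :=
  fineDom_isBlockUnion (by norm_num) _

end

end Literature.MathematicalPhysics.QuantumFieldTheory.Balaban1983to89.B4RegionCov1518
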